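/-
Copyright: lit-balaban Phase-2 proof seat p29 (gen 29).  Statement-level skeleton of a published paper; no proof claims beyond what the
kernel checks below.
-/
import Literature.MathematicalPhysics.QuantumFieldTheory.BalabanImbrieJaffe1984to88.BIJ88LocDeriv230SmallFieldTorus
import Literature.MathematicalPhysics.QuantumFieldTheory.BalabanImbrieJaffe1984to88.BIJ88NeumannPropagatorSmallFieldCubeDeriv
import Literature.MathematicalPhysics.QuantumFieldTheory.BalabanImbrieJaffe1984to88.BIJ88Decay230SmallFieldCubes

/-!
# `BalabanImbrieJaffe1984to88.BIJ88LocDeriv230SmallFieldOpTorus` — T. Bałaban, J. Imbrie, A. Jaffe, *Effective action and cluster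
properties of the abelian Higgs model*, Commun. Math. Phys. **114** (1988) 257–315 [BalabanImbrieJaffe1988], Sect. 2 p. 263 [PDF 7], the
sentence after (2.33): *"Bounds analogous to (2.30), (2.31) hold for covariant derivatives and Hölder derivatives of G_{k,loc}(u) of order less
than two"* — **THE COVARIANT-DERIVATIVE MEMBER AND THE HÖLDER MEMBER OF ORDER `θ ≤ 1` OF (2.30) AT NON-FLAT SMALL FIELDS `u`, IN PRINT'S
OPERATOR (`‖f‖_∞`) FORM, `k`-UNIFORM, FOR THE PRINTED LOCALIZATION DATA** (the torus cubes `{□_α}`, the weights `λ_α` of (2.27) and the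
cut-off `ζ″` of (2.29) of gen 26's `BIJ88LocWeights227Torus`) — the operator-form companion of gen 29's KERNEL-form file
`BIJ88LocDeriv230SmallFieldTorus` (whose HONEST SCOPE (i) deferred exactly this: *"the printed ‖f‖_∞ operator forms do NOT follow k-uniformly
by a row sum … the operator forms follow row by row here"* once p34's `k`-uniform cube derivative member lands — it has: p34 gen 17's
`BIJ88NeumannPropagatorSmallFieldCubeDeriv.decay110_smallField_cube_deriv`, p349321).

statement-level skeleton of published theorems with citation tags; proofs where landed; nothing here is a claim about the Yang–Mills mass gap

PDF held: `paper:balaban1988-cmp114-bij-abelian-higgs-effective-action` (journal page = PDF page + 256); p. 263 [PDF 7] re-read this session on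
the page render `run/shared/lean/pub/lit-balaban/lit-balaban-p31/renders/original-p007-x2.png`; [6] = [Balaban1983RegularityDecay] p. 573
(Theorem, (1.9)/(1.10): *"|(D^η_{A,μ}G_k(Ω,A)f)(x)|, |(G_k(Ω,A)f)(x)| ≦ c₀exp(−δ₀dist(x, supp f))‖f‖_∞ (1.10) for x ∈ Ω, dist(x,Ω^c) ≧ R₀"*;
*"Γ_{x,x′} a shortest contour"*) re-read from the text layer of `paper:balaban1983-cmp89-regularity-decay` p. 3.

CITATION HEADER (lean-in-tree rule).  Part of the lit-balaban TYPED SKELETON (HOME `run/shared/lean/pub/lit-balaban/`), PHASE-2 proof seat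
p29 gen 29 (unit `lit-balaban-p29-g29`; TAKING line HOME/STATUS.md 2026-08-23T02:5xZ — own lineage: this gen's HANDOFF *"NEXT: operator-form
members once p34 g17's cube-derivative member lands"*, p34 g17's 02:46Z cc *"FYI for your HONEST SCOPE (i) «operator forms follow row by
row»: p349321 ACCEPTED"*; free-target protocol G.5-34(d)).  Rows **C2.Claim@263** / **C2.Eq2.30** (owner r18; the abstract hence-step is p08's
`BIJ88HolderDecay230`, unchanged).  Kind: theorems only (no definition, no `Prop`-valued fact; p34's / p27's / p31's / gen 26–29's / T4's
declarations used BY NAME).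

THE PRINTED TEXT (p. 263, verbatim and IN PRINT ORDER; (2.29) precedes — v1.3 doc-only correction, referee ref-5 D-g65-4 / D-g66-1: the
earlier header re-ordered the page, inserted the non-printed connective «Hence the following estimates hold» and dropped the leading constant
`c` of (2.30); re-read on the page image `lit-balaban-p31/renders/original-p007-x2.png`; declarations unchanged).  *"The boundary conditions
are always at a distance O(r(e_k)) from x₁, x₂, so a straightforward application of the random walk expansion of [6] shows that
|(G_{k,loc}(u)f)(x)| ≦ ce^{−c dist(suppt f,x)}‖f‖_∞, (2.30) |(G_{k,loc}(u)f − G_k(Ω,u)f)(x)| ≦ e^{−cr(e_k)}e^{−c dist(suppt f,x)}‖f‖_∞, (2.31)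
for dist(x, Ω^c) ≧ O(r(e_k)). [Each G_k(□_α,u) is close to G_k(Ω,u) for the relevant x₁, x₂, therefore the convex combination and G_{k,loc}
are close also.] We assume that u is smooth in the □_α's entering the sum in (2.27); for (2.31) we assume smoothness throughout the subset
Ω ⊂ T_η. This means that in a neighborhood of each □_α there exists an A, λ such that u = exp[ie_kη(A + ∂λ)] with |∂A|, |∂*A| ≦ O(p(e_k)).
(2.32) … Bounds analogous to (2.30), (2.31) hold for covariant derivatives and Hölder derivatives of G_{k,loc}(u) of order less than two."*

THE MECHANISM (ours, declared — gen 27's two-sum bond identity with the `k`-UNIFORM operator-form cube inputs).  By `covD_gLocT_apply`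
(gen 27), `(D_uG_{k,loc}(u)f)(b) = Σ_α (D_uG_k(□_α,u)g′_α)(b) + ε⁻¹Σ_α (G_k(□_α,u)δg_α)(x)`, `g′_α = ζ″(x′,·)λ_α(x′,·)f`, `δg_α` the
difference source of the two bond ends.  TERM 1: a cube active at the far end `x′ = x + e_μ` contains both bond ends and its exterior INSIDE
`Ω₀` is `≥ R ≥ L^k + 1` away from `x′` (gen 26's row hypothesis (ii)), its exterior OUTSIDE `Ω₀` is `> R₀ ≥ L^k` away from `x` (chart depth), so
the bond is `L^k`-deep in `□_α` (§1 `depth_of_active`) — exactly the row condition of p34's `k`-uniform operator-form derivative member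
`decay110_smallField_cube_deriv` (`‖(D_uG_k(□,u)g)(b)‖ ≤ c₁(L^kε)e^{−t₀D/L^k}‖g‖_∞` for bonds with `dist_∞(x, T∖□) ≥ L^k`, at `u` bondwise
small on `□` with plaquette variables `≤ θ`, `2(d+1)³(L^{2k}θ)² ≤ 1`, `d + 1 ∈ {2,3}`, `L` odd); `≤ m` active labels.  TERM 2: p27's
`k`-uniform operator-form value member `decay110_smallField_cube` on `δg_α` (`‖δg_α‖_∞ ≤ (K/(R₀−R₁) + 3π(d+1)/(2s))‖f‖_∞`, gen 28's
`norm_rowSource_sub_le_of_lipschitz`), `≤ 2m` labels, `ε⁻¹(L^kε)² = (L^kε)L^k`.  HÖLDER `θ ≤ 1` (§3): gen 29's telescoping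
`norm_transport_sub_le_sum_covD` of the transported difference along an admissible bond chain at the non-flat `u`, each bond by §2 at support
distance `≥ D − L^k`; far pairs by two operator-form value members of `G_{k,loc}(u)f` (p31's `opDecay230_smallField` over the `≤ m` labels
active at a deep point).  The smallness of `u` is p27's bondwise form INSIDE `Ω₀` (gen 29's `smallField_cubeFam`, cube by cube) plus p34's
plaquette hypothesis on the torus.

WHAT IS PROVED (theorems only; 0 `sorry`; standard axioms).
* §1 `depth_of_active` (+ private kernels).
* §2 **`deriv230_smallField_op_of_lipschitz`** — for `d + 1 ∈ {2,3}`, `L` odd `> 1`, `a > 0`, `K ≥ 0` THERE EXIST `t₀, C > 0` depending on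
  `(d, L, a, K)` only such that for every volume (`P.d = d+1`, `P.L = L`), every `1 ≤ k ≤ K_P`, every no-wrap box
  `Ω₀ = c·L^k + Π_i[0, L^k·M₀_i)` shorter than the torus with torus gap `≥ R`, `s ≥ 1`, `W ≥ 2s/3 + R₀/2 + R`, `L^k + 1 ≤ R`, `0 ≤ R₁ < R₀`,
  `L^k ≤ R₀`, every Lipschitz cut-off, every `U(1)` field with `|u(∂p) − 1| ≤ θ` (`2(d+1)³(L^{2k}θ)² ≤ 1`) and bondwise small inside `Ω₀`,
  every bond with both ends in `Ω₀` at chart depth `≥ R₀`, every `f` with `‖f‖_∞ ≤ F` supported at sup-torus distance `≥ D ≥ 0` from `x`: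
  `‖(D_uG_{k,loc}(u)f)(⟨x,x+e_μ⟩)‖ ≤ (L^kε)·C·m·(1 + L^k((R₀−R₁)⁻¹ + s⁻¹))·e^{−t₀D/L^k}·F`, `m = (⌊(L^k − 1 + R₀)/s⌋ + 3)^{d+1}`.
* §3 **`holder230_smallField_op_of_lipschitz`** — same data, every `0 ≤ θ ≤ 1`, every admissible bond chain `Γ` from `x₁` to `x₂` (sites in
  `Ω₀` at chart depth `≥ R₀`, within `|x₁ − x₂|_T` of `x₁`, `≤ (d+1)|x₁ − x₂|_T` steps), `f` supported `≥ D` from both points: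
  `(L^k/|x₁ − x₂|_T)^θ·‖u(Γ)(G_{k,loc}(u)f)(x₂) − (G_{k,loc}(u)f)(x₁)‖ ≤ (L^kε)²·C·m·(1 + L^k((R₀−R₁)⁻¹ + s⁻¹))·e^{−t₀D/L^k}·F`.
* §4 **`deriv230_smallField_op_cwt`**, **`deriv230_smallField_op_zetaPi`** (§2 for p13's `cutoff R₁ R₀ |·|_T` of (2.29) and for r18's
  `zetaPi R₁ R₀ 0`, constants from `(d, L, a)` and the universal `K_σ` / `C_σ`), **`exists_contour_holder230_smallField_op_cwt`** ([6]'s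
  shortest-contour ∃-form of §3 for pairs at chart depth `≥ R₀` with `|x₁ − x₂|_T ≤ R₀`, gen 29's `exists_admissible_contour`).
* §6 (v1.2, APPEND-ONLY) **`deriv230_smallPlaquette_op_cwt_instance`** — NON-VACUITY: every hypothesis of §5's `deriv230_smallPlaquette_op_cwt`
  met at once on the genuine two-dimensional `Setup.Params` torus `(ℤ/162)²` (`L = 3`, `k = 1`, `Ω₀ = [0,12)²`, `s = 1`, `W = 7`, `R = 4`, `R₁ = 0`,
  `R₀ = 3`, `u = 1`, `θ = T = 0`, bond `⟨(5,5),(6,5)⟩`).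
* §5 (v1.1, APPEND-ONLY) **`deriv230_smallPlaquette_op_of_lipschitz`**, **`holder230_smallPlaquette_op_of_lipschitz`**,
  **`deriv230_smallPlaquette_op_cwt`**, **`exists_contour_holder230_smallPlaquette_op_cwt`** — THE SAME FOUR MEMBERS UNDER THE PRINTED
  PLAQUETTE SMALLNESS ALONE ([BalabanImbrieJaffe1985] (7.3.1) *"|v(∂p) − 1| ≦ e_kμ(e_k)"*, here a fine-plaquette bound `|u(∂p) − 1| ≤ θ` on the
  torus with `2(d+1)³(L^{2k}θ)² ≤ 1` and a block-scale `T ≥ d(L^k − 1)θ` with `2(L^k−1)L^k(d+1)T² + 2((d+1)(L^k−1)T)² ≤ 1/2`, `2(L^k − 1) + 4 < |T|`):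
  NO bondwise `(T, δ)` hypothesis, NO gauge condition — p34 gen 17's `decay110_smallPlaquette_cube_deriv_uniform` (v1.2, p351452) and p27's
  `decay110_smallPlaquette_cube_uniform` choose the gauge cube by cube; far pairs through p31's `opDecay230_of_input`.
HONEST SCOPE / DIVERGENCE.  (i) `d + 1 ∈ {2, 3}` and `L` odd, `1 ≤ k ≤ K_P` — p34's/p27's hypotheses (the `k`-uniform tilted row bound is
proved there for `d + 1 ≤ 3` only).  (ii) DEEP BONDS / POINTS ONLY: both bond ends (all contour sites) in `Ω₀` at chart depth `≥ R₀ ≥ L^k` and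
`R ≥ L^k + 1` (print's (2.30) has no depth restriction; [6]'s parallelepiped remark is not in the tree — p34's HONEST SCOPE).  (iii) The
smallness of `u`: §2–§4 take p27's bondwise `(T, δ)` form inside `Ω₀` AND p34's plaquette bound `θ` on the whole torus; §5 (v1.1) takes the
plaquette bound ALONE with thresholds from `(d, L^k)` (print's (7.3.1) has `e_kμ(e_k)` for the UNIT-LATTICE field `v`; the fine-plaquette
`θ` here is p27's/p34's reading, their HONEST SCOPE (iv)).  (iv) (2.30)-analogues only; orders `1` and `θ ≤ 1` only (the `1 + θ` member at
non-flat `u` needs [6] (1.9) for cubes at non-flat `u` — p27 g35's lane).  (v) Constants explicit up to p34's/p27's/p31's `(t₀, c)` and the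
universal `K_σ`, `C_σ`; not optimized; `set_option maxHeartbeats 400000` on §3 and on §5's Hölder member (elaboration budget only).  Imports:
gen 29 `BIJ88LocDeriv230SmallFieldTorus` (→ p34 region file, gen 26–28, T4), p34 gen 17 `BIJ88NeumannPropagatorSmallFieldCubeDeriv` (≥ v1.2;
→ p30, p27), p31 `BIJ88Decay230SmallFieldCubes` (→ `BIJ88DeltaLocClose235General`).  Literature + Mathlib only.  Unit `lit-balaban-p29`
(literature-prover-lit-balaban-p29-g29-0), 2026-08-23; v1 = p351363 (ACCEPTED be0a91b131f7), v1.1 = APPEND-ONLY §5 (p352005, ACCEPTED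
6e2a2a194744), v1.2 = APPEND-ONLY §6 (same unit and session; everything before §6 byte-identical to v1.1 except this docstring; the private
`abbrev P2` of §6 is the only def-like token).  NOT summit progress.
-/

open scoped BigOperators Matrix ComplexConjugate
open Finset Matrix

namespace Literature.MathematicalPhysics.QuantumFieldTheory.BalabanImbrieJaffe1984to88.BIJ88LocDeriv230SmallFieldOpTorus

open Literature.MathematicalPhysics.QuantumFieldTheory.Balaban1983to89
open LatticeFieldCalculus (supDist)
open BIJ88Sect3Statements (U1 toC cfg covD starB mem_starB norm_toC)
open BIJ85BlockAveragesTorus BIJ85BlockAveragesTorusK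
open BIJ88NeumannPropagator227Torus (gBox)
open BIJ88DeltaLoc234Torus (gLocT)
open BIJ88NeumannPropagatorFlatDecayCube
open BIJ88NeumannPropagatorFlatClose231 (norm_rowSource_le rowSource_ne_zero abs_lam_le_one)
open BIJ88LocWeights227Torus
open BIJ88LocDeriv230FlatTorus (exists_abs_cutoff_sub_le T_shift_le_one abs_T_shift_sub_le covD_gLocT_apply)
open BIJ88LocDeriv230ZetaPiFlatTorus (norm_rowSource_sub_le_of_lipschitz)
open BIJ88LocDeriv230SmallFieldTorus (smallField_cubeFam norm_transport_sub_le_sum_covD exists_admissible_contour cutoff_hyps)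
open BIJ88NeumannPropagatorSmallFieldCubeDeriv (decay110_smallField_cube_deriv)
open BIJ88NeumannPropagatorSmallFieldSupDecay (decay110_smallField_cube)
open BIJ88Decay230SmallFieldCubes (opDecay230_smallField)
open B3Bound323ZeroTorus (T_eq_supDist)
open T4TreeGaugeFixing (Joins)
open T4TreeGaugeTransform (chainHol)

noncomputable section

variable {d : ℕ} {P : Params}

/-! ## §1 Kernel lemmas -/

/-- kernel: the label of a fine site over its own `k`-block site. [cite: BalabanImbrieJaffe1985, (2.4) p.302, dictionary] -/
private theorem mem_blockK_blkIter {k : ℕ} (x : Balaban1983to89.Site P 0) : x ∈ blockK k (blkIter k x) :=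
  mem_blockK.2 rfl

/-- kernel: `exp (-(t₁ * D / n)) ≤ exp (-(t * (n⁻¹ * D)))` for `t ≤ t₁`, `0 < n`, `0 ≤ D`. [folklore] -/
private theorem exp_div_le {t t₁ n D : ℝ} (ht : t ≤ t₁) (hn : 0 < n) (hD : 0 ≤ D) :
    Real.exp (-(t₁ * D / n)) ≤ Real.exp (-(t * (n⁻¹ * D))) := by
  refine Real.exp_le_exp.2 (neg_le_neg ?_)
  rw [mul_comm n⁻¹ D, ← div_eq_mul_inv, mul_div_assoc]
  exact mul_le_mul_of_nonneg_right ht (div_nonneg hD hn.le)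

/-- **Depth of a deep bond inside an active cube**: if `x ∈ Ω₀` has chart depth `≥ R₀ ≥ L^k`, every point of `Ω₀` outside `□` is at sup-torus
distance `≥ R` from `x + e_μ` with `R ≥ L^k + 1`, then every point outside `□` is at sup-torus distance `≥ L^k` from `x` ([6]'s row condition
*"dist(x, Ω^c) ≧ R₀"* for the cube, one `L^{−k}`-unit deep). [cite: Balaban1983RegularityDecay, Theorem p.573 (1.10)] -/
theorem depth_of_active (hPd : P.d = d + 1) {n : ℕ} {c M0 : Fin (d + 1) → ℕ} (hfit : ∀ i, c i * n + n * M0 i ≤ P.sitesPerDir 0)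
    {R R₀ ρ : ℝ} (hρR : ρ + 1 ≤ R) (hρR₀ : ρ ≤ R₀) {x : Balaban1983to89.Site P 0} {μ : Fin P.d}
    (hdeep : ∀ i, R₀ ≤ (boxCoord hPd n c x i : ℝ) ∧ (boxCoord hPd n c x i : ℝ) + R₀ ≤ (n * M0 i : ℕ) - 1)
    {X : Finset (Balaban1983to89.Site P 0)}
    (hfar : ∀ w ∈ (cubeT hPd n c fun i => n * M0 i), w ∉ X → R ≤ B5Ineq137Torus.T P 0 (x.shift μ) w)
    {w : Balaban1983to89.Site P 0} (hw : w ∉ X) : ρ ≤ B5Ineq137Torus.T P 0 x w := by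
  by_cases hwΩ : w ∈ (cubeT hPd n c fun i => n * M0 i)
  · have h1 := hfar w hwΩ hw
    have h2 := abs_T_shift_sub_le x w μ
    rw [abs_le] at h2
    linarith [h2.2]
  · by_contra hlt
    push Not at hlt
    have hdeepρ : ∀ i, ρ ≤ (boxCoord hPd n c x i : ℝ) ∧ (boxCoord hPd n c x i : ℝ) + ρ ≤ (n * M0 i : ℕ) - 1 :=
      fun i => ⟨hρR₀.trans (hdeep i).1, by linarith [(hdeep i).2]⟩
    exact hwΩ (mem_and_abs_sub_le_of_T_le hPd hfit hdeepρ hlt.le).1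

/-! ## §2 The covariant-derivative member of (2.30) at non-flat small fields, OPERATOR FORM (`k`-uniform), for the torus data of record -/

section Deriv

/-- **THE COVARIANT-DERIVATIVE MEMBER OF (2.30) AT NON-FLAT SMALL FIELDS IN THE PRINTED OPERATOR (`‖f‖_∞`) FORM, `k`-UNIFORM, FOR THE TORUS
CUBES AND WEIGHTS OF RECORD AND ANY LIPSCHITZ CUT-OFF** (p. 263, print order: *"|(G_{k,loc}(u)f)(x)| ≦ ce^{−c dist(suppt f,x)}‖f‖_∞ (2.30) …
We assume that u is smooth in the □_α's entering the sum in (2.27) … Bounds analogous to (2.30), (2.31) hold for covariant derivatives and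
Hölder derivatives of G_{k,loc}(u) of order less than two"*).  For `d + 1 ∈ {2, 3}` directions, `L` odd `> 1`, `a > 0` and every Lipschitz modulus
`K ≥ 0` THERE EXIST `t₀, C > 0` depending on `(d, L, a, K)` only such that for every volume (`P.d = d+1`, `P.L = L`), every `1 ≤ k ≤ K_P`, every
no-wrap box `Ω₀ = c·L^k + Π_i[0, L^k·M₀_i)` shorter than the torus leaving a torus gap `≥ R`, cube spacing `s ≥ 1`, half-width
`W ≥ 2s/3 + R₀/2 + R`, radii `L^k + 1 ≤ R`, `0 ≤ R₁ < R₀`, `L^k ≤ R₀`, every real cut-off `ζ″` (`|ζ″| ≤ 1`, `= 0` beyond `R₀`, one-step modulus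
`≤ K/(R₀ − R₁)`), every `U(1)` field `u` with plaquette variables `|u(∂p) − 1| ≤ θ` on the torus, `2(d+1)³(L^{2k}θ)² ≤ 1`, and bondwise small
inside `Ω₀` (`|u_b − 1| ≤ T` inside `k`-blocks, `|u(Γ^{(k)}) − 1| ≤ δ`, `2(L^k−1)L^k(d+1)T² + 2δ² ≤ 1/2` — p27's/p34's hypothesis, cube by cube),
every bond `⟨x, x+e_μ⟩` with both endpoints in `Ω₀` at chart depth `≥ R₀`, and every `f` with `‖f‖_∞ ≤ F` supported at sup-torus distance
`≥ D ≥ 0` from `x`: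
`‖(D_uG_{k,loc}(u)f)(⟨x, x+e_μ⟩)‖ ≤ (L^kε)·C·m·(1 + L^k((R₀ − R₁)⁻¹ + s⁻¹))·e^{−t₀D/L^k}·‖f‖_∞`, `m = (⌊(L^k − 1 + R₀)/s⌋ + 3)^{d+1}` — gen 27's
two-sum bond identity `covD_gLocT_apply`: p34 gen 17's `k`-uniform operator-form derivative member `decay110_smallField_cube_deriv` for the
cubes active at `x + e_μ` (the bond is `L^k`-deep in each of them: §1), p27's `k`-uniform value member `decay110_smallField_cube` on the
difference sources (gen 27/28's Lipschitz data), times `ε⁻¹(L^kε)² = (L^kε)L^k`. [cite: BalabanImbrieJaffe1988, (2.30) p.263] -/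
theorem deriv230_smallField_op_of_lipschitz (d L : ℕ) (hd1 : 1 ≤ d) (hd3 : d + 1 ≤ 3) (hL : Odd L ∧ 1 < L) {a : ℝ} (ha : 0 < a)
    {K : ℝ} (hK0 : 0 ≤ K) :
    ∃ t₀ C : ℝ, 0 < t₀ ∧ 0 < C ∧ ∀ (P : Params) (hPd : P.d = d + 1), P.L = L →
      ∀ k : ℕ, 1 ≤ k → k ≤ P.K → ∀ (c M0 : Fin (d + 1) → ℕ), (∀ i, 1 ≤ M0 i) →
        (∀ i, c i * P.L ^ k + P.L ^ k * M0 i ≤ P.sitesPerDir 0) → (∀ i, P.L ^ k * M0 i < P.sitesPerDir 0) →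
      ∀ (s W : ℕ), 1 ≤ s → ∀ (R R₀ R₁ : ℝ), (P.L : ℝ) ^ k + 1 ≤ R → 0 ≤ R₁ → R₁ < R₀ → (P.L : ℝ) ^ k ≤ R₀ →
        2 * (s : ℝ) / 3 + R₀ / 2 + R ≤ W → (∀ i, ((P.L ^ k * M0 i : ℕ) : ℝ) + R ≤ P.sitesPerDir 0) →
      ∀ (ζ : Balaban1983to89.Site P 0 → Balaban1983to89.Site P 0 → ℝ), (∀ x y, |ζ x y| ≤ 1) →
        (∀ x y, R₀ ≤ B5Ineq137Torus.T P 0 x y → ζ x y = 0) →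
        (∀ (x y : Balaban1983to89.Site P 0) (ν : Fin P.d), |ζ (x.shift ν) y - ζ x y| ≤ K / (R₀ - R₁)) →
      ∀ (U : GaugeField P 0 U1) (θ Tu δ : ℝ), 0 ≤ θ →
        (∀ p : Balaban1983to89.Plaq P 0, ‖toC (GaugeField.plaqHol U p) - 1‖ ≤ θ) →
        2 * (P.d : ℝ) ^ 3 * (((P.L : ℝ) ^ k) ^ 2 * θ) ^ 2 ≤ 1 →
        (∀ b ∈ starB (cubeT hPd (P.L ^ k) c fun i => P.L ^ k * M0 i), blkIter k b.src = blkIter k b.tgt → ‖toC (U b) - 1‖ ≤ Tu) →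
        (∀ x ∈ (cubeT hPd (P.L ^ k) c fun i => P.L ^ k * M0 i), ‖holCK U k x - 1‖ ≤ δ) →
        2 * (((P.L : ℝ) ^ k - 1) * (P.L : ℝ) ^ k) * P.d * Tu ^ 2 + 2 * δ ^ 2 ≤ 1 / 2 →
      ∀ (x : Balaban1983to89.Site P 0) (μ : Fin P.d),
        x ∈ (cubeT hPd (P.L ^ k) c fun i => P.L ^ k * M0 i) →
        (∀ i, R₀ ≤ (boxCoord hPd (P.L ^ k) c x i : ℝ) ∧ (boxCoord hPd (P.L ^ k) c x i : ℝ) + R₀ ≤ (P.L ^ k * M0 i : ℕ) - 1) →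
        x.shift μ ∈ (cubeT hPd (P.L ^ k) c fun i => P.L ^ k * M0 i) →
        (∀ i, R₀ ≤ (boxCoord hPd (P.L ^ k) c (x.shift μ) i : ℝ) ∧
          (boxCoord hPd (P.L ^ k) c (x.shift μ) i : ℝ) + R₀ ≤ (P.L ^ k * M0 i : ℕ) - 1) →
      ∀ (f : Balaban1983to89.Site P 0 → ℂ) (F D : ℝ), (∀ y, ‖f y‖ ≤ F) → 0 ≤ D → (∀ y, f y ≠ 0 → D ≤ B5Ineq137Torus.T P 0 x y) →
        ‖covD P.eps⁻¹ (cfg U)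
            (gLocT (B1RG242Torus.α P a k * (P.L : ℝ) ^ (k * P.d)) P.eps⁻¹ U k (cubeFam hPd (P.L ^ k) c M0 s W)
              (lamFam hPd (P.L ^ k) c M0 s) ζ *ᵥ f) ⟨x, μ⟩‖ ≤
          P.spacing k * (C * (⌊(((P.L : ℝ) ^ k) - 1 + R₀) / s⌋₊ + 3) ^ (d + 1) *
            (1 + (P.L : ℝ) ^ k * ((R₀ - R₁)⁻¹ + (s : ℝ)⁻¹)) * Real.exp (-(t₀ * (((P.L : ℝ) ^ k)⁻¹ * D))) * F) := by
  obtain ⟨t₁, c₁, ht₁, hc₁, H1⟩ := decay110_smallField_cube_deriv d L hd1 hd3 hL ha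
  obtain ⟨t₂, c₂, ht₂, hc₂, H2⟩ := decay110_smallField_cube d (L - 1) hd3 (by omega) ha
  -- the constants: rate `min t₁ t₂`, prefactor `max c₁ (2c₂·max(K, 3π(d+1)/2) + 1)`
  set Λ₀ : ℝ := max K (3 * Real.pi * (d + 1 : ℕ) / 2) with hΛ₀def
  have hΛ₀0 : 0 ≤ Λ₀ := hK0.trans (le_max_left _ _)
  refine ⟨min t₁ t₂, max c₁ (2 * c₂ * Λ₀ + 1), lt_min ht₁ ht₂, lt_max_of_lt_left hc₁, ?_⟩
  intro P hPd hPL k hk1 hkK c M0 hM0 hfit0 hN0 s W hs R R₀ R₁ hR hR₁ hR10 hLR₀ hW hgap ζ hζabs hζ0 hζlip U θ Tu δ hθ0 hplaq hθs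
    hInt hTree hsmall x μ hx hdeep hxe hdeepe f F D hF hD hsupp
  have hPL' : P.L = L - 1 + 1 := by omega
  set t := min t₁ t₂ with htdef
  set C := max c₁ (2 * c₂ * Λ₀ + 1) with hCdef
  have hδ1 : t ≤ t₁ := min_le_left _ _
  have hδ2 : t ≤ t₂ := min_le_right _ _
  have hC1 : c₁ ≤ C := le_max_left _ _
  have hC2 : 2 * c₂ * Λ₀ + 1 ≤ C := le_max_right _ _
  have hC0 : 0 ≤ C := hc₁.le.trans hC1
  have hn : 1 ≤ P.L ^ k := Nat.one_le_pow _ _ P.L_pos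
  have hk : 0 + k ≤ P.m + P.K := by omega
  have hkmK : k ≤ P.m + P.K := by omega
  have hLpos : (0 : ℝ) < P.L := P.cast_L_pos
  have hLk : (0 : ℝ) < (P.L : ℝ) ^ k := pow_pos hLpos _
  have hLk1 : (1 : ℝ) ≤ (P.L : ℝ) ^ k := by exact_mod_cast hn
  have hR1 : 1 < R := by linarith
  have hR0 : 0 ≤ R := zero_le_one.trans hR1.le
  have hR₀ : 0 ≤ R₀ := hR₁.trans hR10.le
  have hs0 : 0 < s := hs
  have hsr : (0 : ℝ) < s := by exact_mod_cast hs0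
  have hgap' : 0 < R₀ - R₁ := sub_pos.2 hR10
  have hε : 0 < ((P.L : ℝ) ^ k)⁻¹ := inv_pos.mpr hLk
  have hF0 : 0 ≤ F := (norm_nonneg _).trans (hF x)
  have hsp0 : 0 < P.spacing k := P.spacing_pos k
  have heps : 0 < P.eps := P.eps_pos
  -- abbreviations
  set Ω₀ : Finset (Balaban1983to89.Site P 0) := cubeT hPd (P.L ^ k) c fun i => P.L ^ k * M0 i with hΩ₀def
  set A : ℝ := B1RG242Torus.α P a k * (P.L : ℝ) ^ (k * P.d) with hAdef
  set x' := x.shift μ with hx'def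
  set m : ℝ := ((⌊(((P.L : ℝ) ^ k) - 1 + R₀) / s⌋₊ : ℝ) + 3) ^ (d + 1) with hmdef
  have hm0 : 0 ≤ m := by rw [hmdef]; positivity
  set E : ℝ := Real.exp (-(t * (((P.L : ℝ) ^ k)⁻¹ * D))) with hEdef
  have hE0 : 0 < E := Real.exp_pos _
  have hE1 : Real.exp (-(t₁ * D / (P.L : ℝ) ^ k)) ≤ E := exp_div_le hδ1 hLk hD
  have hE2 : Real.exp (-(t₂ * D / (P.L : ℝ) ^ k)) ≤ E := exp_div_le hδ2 hLk hD
  -- the cubes are bondwise small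
  have hcube := smallField_cubeFam hPd hkmK hM0 hfit0 hN0 (s := s) (W := W) hInt hTree
  -- the support of the sources in p27's/p34's `supDist` form
  have hsuppN : ∀ (g : Balaban1983to89.Site P 0 → ℂ), (∀ y, g y ≠ 0 → f y ≠ 0) → ∀ z, g z ≠ 0 → D ≤ (supDist x z : ℝ) := by
    intro g hg z hz
    rw [← T_eq_supDist P x z]
    exact hsupp z (hg z hz)
  -- the sources
  set g' : ↥(labels (P.L ^ k) M0 s) → Balaban1983to89.Site P 0 → ℂ :=
    fun α y => (ζ x' y : ℂ) * (lamFam hPd (P.L ^ k) c M0 s α x' y : ℂ) * f y with hg'def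
  set dg : ↥(labels (P.L ^ k) M0 s) → Balaban1983to89.Site P 0 → ℂ :=
    fun α y => ((ζ x' y : ℂ) * (lamFam hPd (P.L ^ k) c M0 s α x' y : ℂ) - (ζ x y : ℂ) * (lamFam hPd (P.L ^ k) c M0 s α x y : ℂ)) * f y
    with hdgdef
  -- the identity (sources folded)
  have hid : covD P.eps⁻¹ (cfg U) (gLocT A P.eps⁻¹ U k (cubeFam hPd (P.L ^ k) c M0 s W) (lamFam hPd (P.L ^ k) c M0 s) ζ *ᵥ f) ⟨x, μ⟩ =
      ∑ α, covD P.eps⁻¹ (cfg U) (gBox A P.eps⁻¹ U k (cubeFam hPd (P.L ^ k) c M0 s W α) *ᵥ g' α) ⟨x, μ⟩ +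
      ∑ α, ((P.eps⁻¹ : ℝ) : ℂ) * (gBox A P.eps⁻¹ U k (cubeFam hPd (P.L ^ k) c M0 s W α) *ᵥ dg α) x :=
    covD_gLocT_apply P.eps⁻¹ (cfg U) A P.eps⁻¹ U k (cubeFam hPd (P.L ^ k) c M0 s W) (lamFam hPd (P.L ^ k) c M0 s) ζ f ⟨x, μ⟩
  rw [hid]
  -- the active-label sets of the two endpoints
  set Sx : Finset ↥(labels (P.L ^ k) M0 s) := (activeLabels hPd (P.L ^ k) c s R₀ (blkIter k x)).subtype fun α => α ∈ labels (P.L ^ k) M0 s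
    with hSxdef
  set Sx' : Finset ↥(labels (P.L ^ k) M0 s) := (activeLabels hPd (P.L ^ k) c s R₀ (blkIter k x')).subtype fun α => α ∈ labels (P.L ^ k) M0 s
    with hSx'def
  have hcardx : (Sx.card : ℝ) ≤ m := by
    have h1 := card_subtype_activeLabels_le (hPd := hPd) (c := c) (M0 := M0) hn hs0 hR₀ (blkIter k x)
    have e : (((P.L ^ k : ℕ) : ℕ) : ℝ) = (P.L : ℝ) ^ k := by push_cast; rfl
    rw [hSxdef, hmdef]; rw [e] at h1; exact h1
  have hcardx' : (Sx'.card : ℝ) ≤ m := by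
    have h1 := card_subtype_activeLabels_le (hPd := hPd) (c := c) (M0 := M0) hn hs0 hR₀ (blkIter k x')
    have e : (((P.L ^ k : ℕ) : ℕ) : ℝ) = (P.L : ℝ) ^ k := by push_cast; rfl
    rw [hSx'def, hmdef]; rw [e] at h1; exact h1
  have hSx : ∀ (α : ↥(labels (P.L ^ k) M0 s)) (y : Balaban1983to89.Site P 0),
      ζ x y * lamFam hPd (P.L ^ k) c M0 s α x y ≠ 0 → α ∈ Sx := by
    intro α y hne
    rw [hSxdef, Finset.mem_subtype]
    exact mem_activeLabels_of_ne_zero_of_deep hk hs0 hfit0 hζ0 (mem_blockK_blkIter x) hdeep hne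
  have hSx' : ∀ (α : ↥(labels (P.L ^ k) M0 s)) (y : Balaban1983to89.Site P 0),
      ζ x' y * lamFam hPd (P.L ^ k) c M0 s α x' y ≠ 0 → α ∈ Sx' := by
    intro α y hne
    rw [hSx'def, Finset.mem_subtype]
    exact mem_activeLabels_of_ne_zero_of_deep hk hs0 hfit0 hζ0 (mem_blockK_blkIter x') hdeepe hne
  -- TERM 1: p34's derivative member for the cubes active at `x'`
  set B₁ : ℝ := c₁ * P.spacing k * E * F with hB₁def
  have hB₁0 : 0 ≤ B₁ := by positivity
  have hterm1 : ∀ α, ‖covD P.eps⁻¹ (cfg U) (gBox A P.eps⁻¹ U k (cubeFam hPd (P.L ^ k) c M0 s W α) *ᵥ g' α) ⟨x, μ⟩‖ ≤ B₁ := by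
    intro α
    by_cases hex : ∃ y, ζ x' y * lamFam hPd (P.L ^ k) c M0 s α x' y ≠ 0
    · obtain ⟨y₀, hy₀⟩ := hex
      -- the far endpoint is in the active cube, the cube's exterior inside `Ω₀` is `≥ R` away from it
      obtain ⟨-, -, hfar⟩ := rowHyp_ii hPd hn hs0 hfit0 hR0 hgap hW hζ0 hxe hdeepe α y₀ hy₀
      -- so the bond is `L^k`-deep in the cube
      have hdepth : ∀ w, w ∉ cubeFam hPd (P.L ^ k) c M0 s W α → P.L ^ k ≤ supDist x w := by
        intro w hw
        have h1 : ((P.L : ℝ) ^ k) ≤ B5Ineq137Torus.T P 0 x w :=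
          depth_of_active hPd hfit0 hR hLR₀ hdeep (fun w hw' hwn => (hfar w hw' hwn).1) hw
        rw [T_eq_supDist P x w] at h1
        exact_mod_cast h1
      obtain ⟨hBU, hIntα, hTreeα⟩ := hcube α
      obtain ⟨c', M', hM', hfit', hN', hcα⟩ := cubeFam_fits (hPd := hPd) (s := s) (W := W) hM0 hfit0 hN0 α
      rw [hcα] at hIntα hTreeα hdepth ⊢
      refine (H1 P hPd hPL k hk1 hkK c' M' hM' hfit' hN' U θ Tu δ hθ0 hplaq hθs hIntα hTreeα hsmall x μ (g' α) F D
        (fun y => norm_rowSource_le (hζabs x' y) (abs_lam_le_one (sum_abs_lamT_le_one hfit0) α x' y) hF y)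
        (hsuppN (g' α) fun y hy => (rowSource_ne_zero hy).2) hdepth).trans ?_
      rw [hB₁def]
      exact mul_le_mul_of_nonneg_right (mul_le_mul_of_nonneg_left hE1 (by positivity)) hF0
    · push Not at hex
      have h0 : g' α = 0 := by
        funext y; rw [hg'def]; dsimp only; rw [← Complex.ofReal_mul, hex y, Complex.ofReal_zero, zero_mul]; rfl
      rw [h0, mulVec_zero]
      simp only [covD, Pi.zero_apply, mul_zero, sub_zero, norm_zero]
      exact hB₁0
  have hzero1 : ∀ α, α ∉ Sx' → covD P.eps⁻¹ (cfg U) (gBox A P.eps⁻¹ U k (cubeFam hPd (P.L ^ k) c M0 s W α) *ᵥ g' α) ⟨x, μ⟩ = 0 := by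
    intro α hα
    have h0 : g' α = 0 := by
      funext y
      by_contra hne
      exact hα (hSx' α y (rowSource_ne_zero hne).1)
    rw [h0, mulVec_zero]
    simp only [covD, Pi.zero_apply, mul_zero, sub_zero]
  have hsum1 : ‖∑ α, covD P.eps⁻¹ (cfg U) (gBox A P.eps⁻¹ U k (cubeFam hPd (P.L ^ k) c M0 s W α) *ᵥ g' α) ⟨x, μ⟩‖ ≤ m * B₁ := by
    rw [← Finset.sum_subset (Finset.subset_univ Sx') (fun α _ hα => hzero1 α hα)]
    calc ‖∑ α ∈ Sx', covD P.eps⁻¹ (cfg U) (gBox A P.eps⁻¹ U k (cubeFam hPd (P.L ^ k) c M0 s W α) *ᵥ g' α) ⟨x, μ⟩‖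
        ≤ ∑ α ∈ Sx', ‖covD P.eps⁻¹ (cfg U) (gBox A P.eps⁻¹ U k (cubeFam hPd (P.L ^ k) c M0 s W α) *ᵥ g' α) ⟨x, μ⟩‖ := norm_sum_le _ _
      _ ≤ ∑ α ∈ Sx', B₁ := Finset.sum_le_sum fun α _ => hterm1 α
      _ = Sx'.card * B₁ := by rw [Finset.sum_const, nsmul_eq_mul]
      _ ≤ m * B₁ := mul_le_mul_of_nonneg_right hcardx' hB₁0
  -- TERM 2: p27's value member on the difference sources, for the cubes active at `x` or `x'`
  set Λ : ℝ := K / (R₀ - R₁) + 3 * Real.pi * (d + 1 : ℕ) / (2 * s) with hΛdef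
  have hΛ0 : 0 ≤ Λ := by rw [hΛdef]; positivity
  set B₂ : ℝ := c₂ * P.spacing k ^ 2 * E * (Λ * F) with hB₂def
  have hB₂0 : 0 ≤ B₂ := by positivity
  have hterm2 : ∀ α, ‖(gBox A P.eps⁻¹ U k (cubeFam hPd (P.L ^ k) c M0 s W α) *ᵥ dg α) x‖ ≤ B₂ := by
    intro α
    obtain ⟨hBU, hIntα, hTreeα⟩ := hcube α
    obtain ⟨c', M', hM', hfit', hN', hcα⟩ := cubeFam_fits (hPd := hPd) (s := s) (W := W) hM0 hfit0 hN0 α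
    rw [hcα] at hIntα hTreeα ⊢
    refine (H2 P hPd hPL' k hk1 hkmK c' M' hM' hfit' hN' U Tu δ hIntα hTreeα hsmall x (dg α) (Λ * F) D
      (fun y => norm_rowSource_sub_le_of_lipschitz hPd hs0 hfit0 hN0 (div_nonneg hK0 hgap'.le) hζabs (fun y => hζlip x y μ) α.1 hx hxe
        hF y)
      (hsuppN (dg α) fun y hy => right_ne_zero_of_mul hy)).trans ?_
    rw [hB₂def]
    exact mul_le_mul_of_nonneg_right (mul_le_mul_of_nonneg_left hE2 (by positivity)) (by positivity)
  have hzero2 : ∀ α, α ∉ Sx ∪ Sx' → (gBox A P.eps⁻¹ U k (cubeFam hPd (P.L ^ k) c M0 s W α) *ᵥ dg α) x = 0 := by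
    intro α hα
    rw [Finset.mem_union, not_or] at hα
    have h0 : dg α = 0 := by
      funext y
      rw [hdgdef]; dsimp only
      have h1 : ζ x' y * lamFam hPd (P.L ^ k) c M0 s α x' y = 0 := by
        by_contra hne; exact hα.2 (hSx' α y hne)
      have h2 : ζ x y * lamFam hPd (P.L ^ k) c M0 s α x y = 0 := by
        by_contra hne; exact hα.1 (hSx α y hne)
      rw [← Complex.ofReal_mul, ← Complex.ofReal_mul, h1, h2]; simp
    rw [h0, mulVec_zero, Pi.zero_apply]
  have hcardU : ((Sx ∪ Sx').card : ℝ) ≤ 2 * m := by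
    have h1 : ((Sx ∪ Sx').card : ℝ) ≤ (Sx.card : ℝ) + (Sx'.card : ℝ) := by exact_mod_cast Finset.card_union_le _ _
    linarith
  have hsum2 : ‖∑ α, ((P.eps⁻¹ : ℝ) : ℂ) * (gBox A P.eps⁻¹ U k (cubeFam hPd (P.L ^ k) c M0 s W α) *ᵥ dg α) x‖ ≤ P.eps⁻¹ * (2 * m * B₂) := by
    rw [← Finset.mul_sum, norm_mul, Complex.norm_real, Real.norm_eq_abs, abs_of_pos (inv_pos.mpr heps)]
    refine mul_le_mul_of_nonneg_left ?_ (inv_pos.mpr heps).le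
    rw [← Finset.sum_subset (Finset.subset_univ (Sx ∪ Sx')) (fun α _ hα => hzero2 α hα)]
    calc ‖∑ α ∈ Sx ∪ Sx', (gBox A P.eps⁻¹ U k (cubeFam hPd (P.L ^ k) c M0 s W α) *ᵥ dg α) x‖
        ≤ ∑ α ∈ Sx ∪ Sx', ‖(gBox A P.eps⁻¹ U k (cubeFam hPd (P.L ^ k) c M0 s W α) *ᵥ dg α) x‖ := norm_sum_le _ _
      _ ≤ ∑ α ∈ Sx ∪ Sx', B₂ := Finset.sum_le_sum fun α _ => hterm2 α
      _ = (Sx ∪ Sx').card * B₂ := by rw [Finset.sum_const, nsmul_eq_mul]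
      _ ≤ 2 * m * B₂ := mul_le_mul_of_nonneg_right hcardU hB₂0
  -- assembling: `m·B₁ + ε⁻¹·2m·B₂ ≤ (L^kε)·C·m·(1 + L^k((R₀−R₁)⁻¹ + s⁻¹))·E·F`
  have hscale : P.eps⁻¹ * P.spacing k ^ 2 = P.spacing k * (P.L : ℝ) ^ k := by
    rw [Params.spacing]
    field_simp
  have hΛle : Λ ≤ Λ₀ * ((R₀ - R₁)⁻¹ + (s : ℝ)⁻¹) := by
    rw [hΛdef, mul_add]
    refine add_le_add ?_ ?_
    · rw [div_eq_mul_inv]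
      exact mul_le_mul_of_nonneg_right (le_max_left _ _) (inv_pos.mpr hgap').le
    · have e : 3 * Real.pi * (d + 1 : ℕ) / (2 * s) = (3 * Real.pi * (d + 1 : ℕ) / 2) * (s : ℝ)⁻¹ := by
        field_simp
      rw [e]
      exact mul_le_mul_of_nonneg_right (le_max_right _ _) (inv_pos.mpr hsr).le
  have h1 : m * B₁ ≤ P.spacing k * (C * m * 1 * E * F) := by
    have : B₁ ≤ P.spacing k * (C * E * F) := by
      rw [hB₁def]
      calc c₁ * P.spacing k * E * F = P.spacing k * (c₁ * E * F) := by ring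
        _ ≤ P.spacing k * (C * E * F) :=
            mul_le_mul_of_nonneg_left (mul_le_mul_of_nonneg_right (mul_le_mul_of_nonneg_right hC1 hE0.le) hF0) hsp0.le
    calc m * B₁ ≤ m * (P.spacing k * (C * E * F)) := mul_le_mul_of_nonneg_left this hm0
      _ = P.spacing k * (C * m * 1 * E * F) := by ring
  have h2 : P.eps⁻¹ * (2 * m * B₂) ≤ P.spacing k * (C * m * ((P.L : ℝ) ^ k * ((R₀ - R₁)⁻¹ + (s : ℝ)⁻¹)) * E * F) := by
    have e : P.eps⁻¹ * (2 * m * B₂) = P.spacing k * ((2 * c₂ * Λ) * m * (P.L : ℝ) ^ k * E * F) := by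
      rw [hB₂def]
      have : P.eps⁻¹ * (2 * m * (c₂ * P.spacing k ^ 2 * E * (Λ * F))) =
          (P.eps⁻¹ * P.spacing k ^ 2) * (2 * c₂ * Λ * m * E * F) := by ring
      rw [this, hscale]; ring
    rw [e]
    refine mul_le_mul_of_nonneg_left ?_ hsp0.le
    have hcoef : 2 * c₂ * Λ * m * (P.L : ℝ) ^ k ≤ C * m * ((P.L : ℝ) ^ k * ((R₀ - R₁)⁻¹ + (s : ℝ)⁻¹)) := by
      have h3 : 2 * c₂ * Λ ≤ C * ((R₀ - R₁)⁻¹ + (s : ℝ)⁻¹) := by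
        calc 2 * c₂ * Λ ≤ 2 * c₂ * (Λ₀ * ((R₀ - R₁)⁻¹ + (s : ℝ)⁻¹)) := mul_le_mul_of_nonneg_left hΛle (by positivity)
          _ = (2 * c₂ * Λ₀) * ((R₀ - R₁)⁻¹ + (s : ℝ)⁻¹) := by ring
          _ ≤ C * ((R₀ - R₁)⁻¹ + (s : ℝ)⁻¹) :=
              mul_le_mul_of_nonneg_right (by linarith) (by positivity)
      calc 2 * c₂ * Λ * m * (P.L : ℝ) ^ k = (2 * c₂ * Λ) * (m * (P.L : ℝ) ^ k) := by ring
        _ ≤ (C * ((R₀ - R₁)⁻¹ + (s : ℝ)⁻¹)) * (m * (P.L : ℝ) ^ k) := mul_le_mul_of_nonneg_right h3 (by positivity)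
        _ = C * m * ((P.L : ℝ) ^ k * ((R₀ - R₁)⁻¹ + (s : ℝ)⁻¹)) := by ring
    exact mul_le_mul_of_nonneg_right (mul_le_mul_of_nonneg_right hcoef hE0.le) hF0
  refine ((norm_add_le _ _).trans (add_le_add hsum1 hsum2)).trans ?_
  calc m * B₁ + P.eps⁻¹ * (2 * m * B₂)
      ≤ P.spacing k * (C * m * 1 * E * F) + P.spacing k * (C * m * ((P.L : ℝ) ^ k * ((R₀ - R₁)⁻¹ + (s : ℝ)⁻¹)) * E * F) :=
        add_le_add h1 h2
    _ = P.spacing k * (C * m * (1 + (P.L : ℝ) ^ k * ((R₀ - R₁)⁻¹ + (s : ℝ)⁻¹)) * E * F) := by ring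

end Deriv

/-! ## §3 The Hölder member of order `θ ≤ 1` of (2.30) at non-flat small fields, OPERATOR FORM, along admissible contours -/

section Holder

/-- kernel: for `1 ≤ t` and `θ ≤ 1`, `t^θ ≤ t`. [folklore] -/
private theorem rpow_le_self_of_one_le {t θ : ℝ} (ht : 1 ≤ t) (hθ : θ ≤ 1) : t ^ θ ≤ t := by
  have h := Real.rpow_le_rpow_of_exponent_le ht hθ
  rwa [Real.rpow_one] at h

/-- kernel: `exp (-(t₁ * (n⁻¹ * T))) ≤ exp t₁ * exp (-(t * (n⁻¹ * D)))` when `0 < t ≤ t₁`, `0 < n`, `0 ≤ D`, `D - n ≤ T`. [folklore] -/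
private theorem exp_near_le {t t₁ n D T : ℝ} (ht : 0 < t) (ht₁ : t ≤ t₁) (hn : 0 < n) (hD : 0 ≤ D) (hT : D - n ≤ T) :
    Real.exp (-(t₁ * (n⁻¹ * T))) ≤ Real.exp t₁ * Real.exp (-(t * (n⁻¹ * D))) := by
  rw [← Real.exp_add]
  refine Real.exp_le_exp.2 ?_
  have h1 : n⁻¹ * (D - n) ≤ n⁻¹ * T := mul_le_mul_of_nonneg_left hT (inv_pos.2 hn).le
  have h2 : n⁻¹ * (D - n) = n⁻¹ * D - 1 := by field_simp
  have h3 : t * (n⁻¹ * D) ≤ t₁ * (n⁻¹ * D) := mul_le_mul_of_nonneg_right ht₁ (by positivity)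
  have h4 : t₁ * (n⁻¹ * D - 1) ≤ t₁ * (n⁻¹ * T) := mul_le_mul_of_nonneg_left (h2 ▸ h1) (ht.le.trans ht₁)
  nlinarith

set_option maxHeartbeats 400000 in
/-- **THE HÖLDER MEMBER OF ORDER `θ ≤ 1` OF (2.30) AT NON-FLAT SMALL FIELDS IN THE PRINTED OPERATOR (`‖f‖_∞`) FORM, `k`-UNIFORM, FOR THE TORUS
CUBES AND WEIGHTS OF RECORD AND ANY LIPSCHITZ CUT-OFF, ALONG EVERY ADMISSIBLE CONTOUR** (p. 263: *"Bounds analogous to (2.30), (2.31) hold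
for covariant derivatives and Hölder derivatives of G_{k,loc}(u) of order less than two"*; [6] p. 573 (1.9): the transport `U(A(Γ_{x,x′}))`
along *"a shortest contour connecting these points"*).  With the data and hypotheses of `deriv230_smallField_op_of_lipschitz`, for every
exponent `0 ≤ θ ≤ 1`, every pair `x₁, x₂` joined by a bond chain `Γ = (x₁ = s_0, …, s_n = x₂)` of `n ≤ (d+1)|x₁ − x₂|_T` steps all of whose
sites lie in `Ω₀` at chart depth `≥ R₀` and within sup-torus distance `|x₁ − x₂|_T` of `x₁`, and every `f` with `‖f‖_∞ ≤ F` supported at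
sup-torus distance `≥ D ≥ 0` from `x₁` and from `x₂`:
`(L^k/|x₁ − x₂|_T)^θ·‖u(Γ)(G_{k,loc}(u)f)(x₂) − (G_{k,loc}(u)f)(x₁)‖ ≤ (L^kε)²·C·m·(1 + L^k((R₀ − R₁)⁻¹ + s⁻¹))·e^{−t₀D/L^k}·‖f‖_∞`,
`u(Γ) = Π_m u(c_m)^{±1}` (T4's `chainHol`) — NEAR PAIRS (`|x₁ − x₂|_T ≤ L^k`): §2 telescoped bond by bond along `Γ` at the non-flat `u` (gen
29's `norm_transport_sub_le_sum_covD`), `(L^k/T)^θ·(d+1)T·ε ≤ (d+1)L^kε`, support distance `≥ D − L^k` from the contour; FAR PAIRS: two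
operator-form value members (p31's `opDecay230_smallField` over the `≤ m` labels active at a deep point), `|u(Γ)| = 1`.
[cite: BalabanImbrieJaffe1988, (2.30) p.263] -/
theorem holder230_smallField_op_of_lipschitz (d L : ℕ) (hd1 : 1 ≤ d) (hd3 : d + 1 ≤ 3) (hL : Odd L ∧ 1 < L) {a : ℝ} (ha : 0 < a)
    {K : ℝ} (hK0 : 0 ≤ K) :
    ∃ t₀ C : ℝ, 0 < t₀ ∧ 0 < C ∧ ∀ (P : Params) (hPd : P.d = d + 1), P.L = L →
      ∀ k : ℕ, 1 ≤ k → k ≤ P.K → ∀ (c M0 : Fin (d + 1) → ℕ), (∀ i, 1 ≤ M0 i) →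
        (∀ i, c i * P.L ^ k + P.L ^ k * M0 i ≤ P.sitesPerDir 0) → (∀ i, P.L ^ k * M0 i < P.sitesPerDir 0) →
      ∀ (s W : ℕ), 1 ≤ s → ∀ (R R₀ R₁ : ℝ), (P.L : ℝ) ^ k + 1 ≤ R → 0 ≤ R₁ → R₁ < R₀ → (P.L : ℝ) ^ k ≤ R₀ →
        2 * (s : ℝ) / 3 + R₀ / 2 + R ≤ W → (∀ i, ((P.L ^ k * M0 i : ℕ) : ℝ) + R ≤ P.sitesPerDir 0) →
      ∀ (ζ : Balaban1983to89.Site P 0 → Balaban1983to89.Site P 0 → ℝ), (∀ x y, |ζ x y| ≤ 1) →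
        (∀ x y, R₀ ≤ B5Ineq137Torus.T P 0 x y → ζ x y = 0) →
        (∀ (x y : Balaban1983to89.Site P 0) (ν : Fin P.d), |ζ (x.shift ν) y - ζ x y| ≤ K / (R₀ - R₁)) →
      ∀ (U : GaugeField P 0 U1) (θp Tu δ : ℝ), 0 ≤ θp →
        (∀ p : Balaban1983to89.Plaq P 0, ‖toC (GaugeField.plaqHol U p) - 1‖ ≤ θp) →
        2 * (P.d : ℝ) ^ 3 * (((P.L : ℝ) ^ k) ^ 2 * θp) ^ 2 ≤ 1 →
        (∀ b ∈ starB (cubeT hPd (P.L ^ k) c fun i => P.L ^ k * M0 i), blkIter k b.src = blkIter k b.tgt → ‖toC (U b) - 1‖ ≤ Tu) →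
        (∀ x ∈ (cubeT hPd (P.L ^ k) c fun i => P.L ^ k * M0 i), ‖holCK U k x - 1‖ ≤ δ) →
        2 * (((P.L : ℝ) ^ k - 1) * (P.L : ℝ) ^ k) * P.d * Tu ^ 2 + 2 * δ ^ 2 ≤ 1 / 2 →
      ∀ (θ : ℝ), 0 ≤ θ → θ ≤ 1 →
      ∀ (x₁ x₂ : Balaban1983to89.Site P 0) (n : ℕ) (sq : ℕ → Balaban1983to89.Site P 0) (cb : ℕ → PBond P 0),
        sq 0 = x₁ → sq n = x₂ → (∀ m < n, Joins (cb m) (sq m) (sq (m + 1))) →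
        (n : ℝ) ≤ ((d : ℝ) + 1) * B5Ineq137Torus.T P 0 x₁ x₂ →
        (∀ m ≤ n, sq m ∈ (cubeT hPd (P.L ^ k) c fun i => P.L ^ k * M0 i) ∧
          (∀ i, R₀ ≤ (boxCoord hPd (P.L ^ k) c (sq m) i : ℝ) ∧ (boxCoord hPd (P.L ^ k) c (sq m) i : ℝ) + R₀ ≤ (P.L ^ k * M0 i : ℕ) - 1) ∧
          B5Ineq137Torus.T P 0 x₁ (sq m) ≤ B5Ineq137Torus.T P 0 x₁ x₂) →
      ∀ (f : Balaban1983to89.Site P 0 → ℂ) (F D : ℝ), (∀ y, ‖f y‖ ≤ F) → 0 ≤ D →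
        (∀ y, f y ≠ 0 → D ≤ B5Ineq137Torus.T P 0 x₁ y) → (∀ y, f y ≠ 0 → D ≤ B5Ineq137Torus.T P 0 x₂ y) →
        ((P.L : ℝ) ^ k / B5Ineq137Torus.T P 0 x₁ x₂) ^ θ *
          ‖toC (chainHol sq cb U n) *
              (gLocT (B1RG242Torus.α P a k * (P.L : ℝ) ^ (k * P.d)) P.eps⁻¹ U k (cubeFam hPd (P.L ^ k) c M0 s W)
                (lamFam hPd (P.L ^ k) c M0 s) ζ *ᵥ f) x₂ -
            (gLocT (B1RG242Torus.α P a k * (P.L : ℝ) ^ (k * P.d)) P.eps⁻¹ U k (cubeFam hPd (P.L ^ k) c M0 s W)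
                (lamFam hPd (P.L ^ k) c M0 s) ζ *ᵥ f) x₁‖ ≤
          P.spacing k ^ 2 * (C * (⌊(((P.L : ℝ) ^ k) - 1 + R₀) / s⌋₊ + 3) ^ (d + 1) *
            (1 + (P.L : ℝ) ^ k * ((R₀ - R₁)⁻¹ + (s : ℝ)⁻¹)) * Real.exp (-(t₀ * (((P.L : ℝ) ^ k)⁻¹ * D))) * F) := by
  obtain ⟨t₁, C₁, ht₁, hC₁, H1⟩ := deriv230_smallField_op_of_lipschitz d L hd1 hd3 hL ha hK0
  obtain ⟨t₃, c₃, ht₃, hc₃, H3⟩ := opDecay230_smallField d (L - 1) hd3 (by omega) ha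
  set t : ℝ := min t₁ t₃ with htdef
  have ht0 : 0 < t := lt_min ht₁ ht₃
  have htt₁ : t ≤ t₁ := min_le_left _ _
  have htt₃ : t ≤ t₃ := min_le_right _ _
  refine ⟨t, max (((d : ℝ) + 1) * Real.exp t₁ * C₁) (2 * c₃), ht0, lt_max_of_lt_right (by positivity), ?_⟩
  intro P hPd hPL k hk1 hkK c M0 hM0 hfit0 hN0 s W hs R R₀ R₁ hR hR₁ hR10 hLR₀ hW hgap ζ hζabs hζ0 hζlip U θp Tu δ hθp0 hplaq hθps
    hInt hTree hsmall θ hθ0 hθ1 x₁ x₂ n sq cb hsq0 hsqn hJ hnle hchain f F D hF hD hsupp₁ hsupp₂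
  have hPL' : P.L = L - 1 + 1 := by omega
  set C := max (((d : ℝ) + 1) * Real.exp t₁ * C₁) (2 * c₃) with hCdef
  have hCa : ((d : ℝ) + 1) * Real.exp t₁ * C₁ ≤ C := le_max_left _ _
  have hCb : 2 * c₃ ≤ C := le_max_right _ _
  have hC0 : 0 ≤ C := le_trans (by positivity) hCb
  have hn : 1 ≤ P.L ^ k := Nat.one_le_pow _ _ P.L_pos
  have hk : 0 + k ≤ P.m + P.K := by omega
  have hkmK : k ≤ P.m + P.K := by omega
  have hR₀ : 0 ≤ R₀ := hR₁.trans hR10.le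
  have hs0 : 0 < s := hs
  have hLpos : (0 : ℝ) < P.L := P.cast_L_pos
  have hLk : (0 : ℝ) < (P.L : ℝ) ^ k := pow_pos hLpos _
  have hLkinv : 0 < ((P.L : ℝ) ^ k)⁻¹ := inv_pos.mpr hLk
  have hsp0 : 0 < P.spacing k := P.spacing_pos k
  have heps : 0 < P.eps := P.eps_pos
  have hsr : (0 : ℝ) < s := by exact_mod_cast hs
  have hgap' : 0 < R₀ - R₁ := sub_pos.2 hR10
  have hF0 : 0 ≤ F := (norm_nonneg _).trans (hF x₁)
  have hT0 : 0 ≤ B5Ineq137Torus.T P 0 x₁ x₂ := B5Ineq137Torus.T_nonneg P 0 x₁ x₂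
  -- the end points are chain sites
  obtain ⟨hx₁, hdeep₁, -⟩ := hsq0 ▸ hchain 0 (Nat.zero_le n)
  obtain ⟨hx₂, hdeep₂, -⟩ := hsqn ▸ hchain n le_rfl
  -- abbreviations
  set A : ℝ := B1RG242Torus.α P a k * (P.L : ℝ) ^ (k * P.d) with hAdef
  set ψ : Balaban1983to89.Site P 0 → ℂ :=
    gLocT A P.eps⁻¹ U k (cubeFam hPd (P.L ^ k) c M0 s W) (lamFam hPd (P.L ^ k) c M0 s) ζ *ᵥ f with hψdef
  set T12 : ℝ := B5Ineq137Torus.T P 0 x₁ x₂ with hT12def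
  set m : ℝ := ((⌊(((P.L : ℝ) ^ k) - 1 + R₀) / s⌋₊ : ℝ) + 3) ^ (d + 1) with hmdef
  have hm0 : 0 ≤ m := by rw [hmdef]; positivity
  have hm1 : 1 ≤ m := by
    rw [hmdef]
    have h0 : (0 : ℝ) ≤ (⌊(((P.L : ℝ) ^ k) - 1 + R₀) / s⌋₊ : ℝ) := Nat.cast_nonneg _
    have : (1 : ℝ) ≤ (⌊(((P.L : ℝ) ^ k) - 1 + R₀) / s⌋₊ : ℝ) + 3 := by linarith
    exact one_le_pow₀ this
  set br : ℝ := 1 + (P.L : ℝ) ^ k * ((R₀ - R₁)⁻¹ + (s : ℝ)⁻¹) with hbrdef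
  have hbr1 : 1 ≤ br := by rw [hbrdef]; exact le_add_of_nonneg_right (by positivity)
  have hbr0 : 0 ≤ br := zero_le_one.trans hbr1
  set Ex : ℝ := Real.exp (-(t * (((P.L : ℝ) ^ k)⁻¹ * D))) with hEdef
  have hE0 : 0 < Ex := Real.exp_pos _
  have hεD : 0 ≤ ((P.L : ℝ) ^ k)⁻¹ * D := mul_nonneg hLkinv.le hD
  set w : ℝ := ((P.L : ℝ) ^ k / T12) ^ θ with hwdef
  have hw0 : 0 ≤ w := Real.rpow_nonneg (div_nonneg hLk.le hT0) θ
  show w * ‖toC (chainHol sq cb U n) * ψ x₂ - ψ x₁‖ ≤ P.spacing k ^ 2 * (C * m * br * Ex * F)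
  by_cases hnear : T12 ≤ (P.L : ℝ) ^ k
  · /- NEAR PAIRS: the derivative member telescoped along the contour -/
    set D' : ℝ := max (D - T12) 0 with hD'def
    have hD'0 : 0 ≤ D' := le_max_right _ _
    set B : ℝ := P.spacing k * (C₁ * m * br * (Real.exp t₁ * Ex) * F) with hBdef
    have hB0 : 0 ≤ B := by positivity
    have hbond : ∀ m' < n, ‖covD P.eps⁻¹ (cfg U) ψ (cb m')‖ ≤ B := by
      intro m' hm'
      obtain ⟨hmem0, hdeep0, hclose0⟩ := hchain m' hm'.le
      obtain ⟨hmem1, hdeep1, hclose1⟩ := hchain (m' + 1) (Nat.succ_le_of_lt hm')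
      have hb : cb m' = ⟨(cb m').src, (cb m').dir⟩ := rfl
      have htgt : (cb m').tgt = (cb m').src.shift (cb m').dir := rfl
      have hends : ((cb m').src ∈ (cubeT hPd (P.L ^ k) c fun i => P.L ^ k * M0 i) ∧
          (∀ i, R₀ ≤ (boxCoord hPd (P.L ^ k) c (cb m').src i : ℝ) ∧
            (boxCoord hPd (P.L ^ k) c (cb m').src i : ℝ) + R₀ ≤ (P.L ^ k * M0 i : ℕ) - 1) ∧
          B5Ineq137Torus.T P 0 x₁ (cb m').src ≤ T12) ∧
          ((cb m').src.shift (cb m').dir ∈ (cubeT hPd (P.L ^ k) c fun i => P.L ^ k * M0 i) ∧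
          (∀ i, R₀ ≤ (boxCoord hPd (P.L ^ k) c ((cb m').src.shift (cb m').dir) i : ℝ) ∧
            (boxCoord hPd (P.L ^ k) c ((cb m').src.shift (cb m').dir) i : ℝ) + R₀ ≤ (P.L ^ k * M0 i : ℕ) - 1)) := by
        rw [← htgt]
        rcases hJ m' hm' with ⟨h1, h2⟩ | ⟨h1, h2⟩
        · rw [h1, h2]; exact ⟨⟨hmem0, hdeep0, hclose0⟩, hmem1, hdeep1⟩
        · rw [h1, h2]; exact ⟨⟨hmem1, hdeep1, hclose1⟩, hmem0, hdeep0⟩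
      obtain ⟨⟨hzmem, hzdeep, hzclose⟩, hzemem, hzedeep⟩ := hends
      have hD'supp : ∀ y, f y ≠ 0 → D' ≤ B5Ineq137Torus.T P 0 (cb m').src y := by
        intro y hy
        refine max_le ?_ (B5Ineq137Torus.T_nonneg P 0 _ y)
        have h1 := hsupp₁ y hy
        have h2 := B5Ineq137Torus.T_triangle P 0 x₁ (cb m').src y
        linarith
      have hder := H1 P hPd hPL k hk1 hkK c M0 hM0 hfit0 hN0 s W hs R R₀ R₁ hR hR₁ hR10 hLR₀ hW hgap ζ hζabs hζ0 hζlip U θp Tu δ hθp0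
        hplaq hθps hInt hTree hsmall (cb m').src (cb m').dir hzmem hzdeep hzemem hzedeep f F D' hF hD'0 hD'supp
      rw [← hb] at hder
      refine hder.trans ?_
      have hTz : D - (P.L : ℝ) ^ k ≤ D' := le_trans (by linarith) (le_max_left _ _)
      have hexp := exp_near_le ht0 htt₁ hLk hD hTz
      rw [hBdef, ← hmdef, ← hbrdef]
      refine mul_le_mul_of_nonneg_left ?_ hsp0.le
      exact mul_le_mul_of_nonneg_right (mul_le_mul_of_nonneg_left hexp (by positivity)) hF0
    -- telescoping along the contour
    have htel := norm_transport_sub_le_sum_covD U (inv_ne_zero heps.ne') ψ sq cb n hJ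
    rw [hsq0, hsqn, abs_inv, abs_of_pos heps, inv_inv] at htel
    have hsum : ∑ m' ∈ Finset.range n, ‖covD P.eps⁻¹ (cfg U) ψ (cb m')‖ ≤ n * B := by
      calc ∑ m' ∈ Finset.range n, ‖covD P.eps⁻¹ (cfg U) ψ (cb m')‖ ≤ ∑ _m' ∈ Finset.range n, B :=
            Finset.sum_le_sum fun m' hm' => hbond m' (Finset.mem_range.1 hm')
        _ = n * B := by rw [Finset.sum_const, Finset.card_range, nsmul_eq_mul]
    have hdiff : ‖toC (chainHol sq cb U n) * ψ x₂ - ψ x₁‖ ≤ P.eps * (n * B) :=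
      htel.trans (mul_le_mul_of_nonneg_left hsum heps.le)
    -- the weight against the number of steps: `w·ε·n ≤ (d+1)·L^k·ε`
    have hwT : w * (P.eps * (n * B)) ≤ ((d : ℝ) + 1) * (P.eps * (P.L : ℝ) ^ k) * B := by
      rcases hT0.eq_or_lt with hT00 | hTpos
      · have hn0 : (n : ℝ) = 0 := le_antisymm (by rw [← hT00, mul_zero] at hnle; exact hnle) (Nat.cast_nonneg n)
        rw [hn0, zero_mul, mul_zero, mul_zero]
        positivity
      · have hq : 1 ≤ (P.L : ℝ) ^ k / T12 := by rw [le_div_iff₀ hTpos, one_mul]; exact hnear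
        have hw1 : w ≤ (P.L : ℝ) ^ k / T12 := rpow_le_self_of_one_le hq hθ1
        calc w * (P.eps * (n * B)) ≤ (P.L : ℝ) ^ k / T12 * (P.eps * ((((d : ℝ) + 1) * T12) * B)) :=
              mul_le_mul hw1 (mul_le_mul_of_nonneg_left (mul_le_mul_of_nonneg_right hnle hB0) heps.le) (by positivity)
                (div_nonneg hLk.le hT0)
          _ = ((d : ℝ) + 1) * (P.eps * (P.L : ℝ) ^ k) * B := by
              rw [div_mul_eq_mul_div, div_eq_iff hTpos.ne']
              ring
    have hspacing : P.eps * (P.L : ℝ) ^ k = P.spacing k := by rw [Params.spacing]; ring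
    calc w * ‖toC (chainHol sq cb U n) * ψ x₂ - ψ x₁‖ ≤ w * (P.eps * (n * B)) := mul_le_mul_of_nonneg_left hdiff hw0
      _ ≤ ((d : ℝ) + 1) * (P.eps * (P.L : ℝ) ^ k) * B := hwT
      _ = P.spacing k ^ 2 * ((((d : ℝ) + 1) * Real.exp t₁ * C₁) * m * br * Ex * F) := by rw [hspacing, hBdef]; ring
      _ ≤ P.spacing k ^ 2 * (C * m * br * Ex * F) := by
          refine mul_le_mul_of_nonneg_left ?_ (sq_nonneg _)
          exact mul_le_mul_of_nonneg_right (mul_le_mul_of_nonneg_right (mul_le_mul_of_nonneg_right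
            (mul_le_mul_of_nonneg_right hCa hm0) hbr0) hE0.le) hF0
  · /- FAR PAIRS: two operator-form value members -/
    push Not at hnear
    have hTpos : 0 < T12 := hLk.trans hnear
    have hw1 : w ≤ 1 := by
      refine Real.rpow_le_one (div_nonneg hLk.le hT0) ?_ hθ0
      rw [div_le_one hTpos]; exact hnear.le
    have hcube := smallField_cubeFam hPd hkmK hM0 hfit0 hN0 (s := s) (W := W) hInt hTree
    have hval : ∀ x : Balaban1983to89.Site P 0, x ∈ (cubeT hPd (P.L ^ k) c fun i => P.L ^ k * M0 i) →
        (∀ i, R₀ ≤ (boxCoord hPd (P.L ^ k) c x i : ℝ) ∧ (boxCoord hPd (P.L ^ k) c x i : ℝ) + R₀ ≤ (P.L ^ k * M0 i : ℕ) - 1) →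
        (∀ y, f y ≠ 0 → D ≤ B5Ineq137Torus.T P 0 x y) → ‖ψ x‖ ≤ P.spacing k ^ 2 * (m * (c₃ * Ex * F)) := by
      intro x hx hdeepx hsuppx
      set S : Finset ↥(labels (P.L ^ k) M0 s) :=
        (activeLabels hPd (P.L ^ k) c s R₀ (blkIter k x)).subtype fun α => α ∈ labels (P.L ^ k) M0 s with hSdef
      have hS : ∀ (α : ↥(labels (P.L ^ k) M0 s)) (y : Balaban1983to89.Site P 0),
          ζ x y * lamFam hPd (P.L ^ k) c M0 s α x y ≠ 0 → f y ≠ 0 → α ∈ S := by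
        intro α y hne _
        rw [hSdef, Finset.mem_subtype]
        exact mem_activeLabels_of_ne_zero_of_deep hk hs0 hfit0 hζ0 (mem_blockK_blkIter x) hdeepx hne
      have hcard : (S.card : ℝ) ≤ m := by
        have h1 := card_subtype_activeLabels_le (hPd := hPd) (c := c) (M0 := M0) hn hs0 hR₀ (blkIter k x)
        have e : (((P.L ^ k : ℕ) : ℕ) : ℝ) = (P.L : ℝ) ^ k := by push_cast; rfl
        rw [hSdef, hmdef]; rw [e] at h1; exact h1
      have h := H3 P hPd hPL' k hk1 hkmK ↥(labels (P.L ^ k) M0 s) (cubeFam hPd (P.L ^ k) c M0 s W) (lamFam hPd (P.L ^ k) c M0 s) ζ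
        (fun α => cubeFam_fits (hPd := hPd) (s := s) (W := W) hM0 hfit0 hN0 α) (sum_abs_lamT_le_one hfit0) hζabs U Tu δ
        (fun α => (hcube α).2.1) (fun α => (hcube α).2.2) hsmall x f F D hF hsuppx S hS
      refine h.trans (mul_le_mul_of_nonneg_left ?_ (sq_nonneg _))
      have hE3 : Real.exp (-(t₃ * (((P.L : ℝ) ^ k)⁻¹ * D))) ≤ Ex :=
        Real.exp_le_exp.2 (neg_le_neg (mul_le_mul_of_nonneg_right htt₃ hεD))
      calc (S.card : ℝ) * (c₃ * Real.exp (-(t₃ * (((P.L : ℝ) ^ k)⁻¹ * D))) * F) ≤ m * (c₃ * Real.exp (-(t₃ * (((P.L : ℝ) ^ k)⁻¹ * D))) * F) :=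
            mul_le_mul_of_nonneg_right hcard (by positivity)
        _ ≤ m * (c₃ * Ex * F) := mul_le_mul_of_nonneg_left (mul_le_mul_of_nonneg_right (mul_le_mul_of_nonneg_left hE3 hc₃.le) hF0) hm0
    have h1 := hval x₁ hx₁ hdeep₁ hsupp₁
    have h2 := hval x₂ hx₂ hdeep₂ hsupp₂
    have hsub : ‖toC (chainHol sq cb U n) * ψ x₂ - ψ x₁‖ ≤ P.spacing k ^ 2 * (m * (c₃ * Ex * F)) + P.spacing k ^ 2 * (m * (c₃ * Ex * F)) := by
      refine (norm_sub_le _ _).trans (add_le_add ?_ h1)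
      rw [norm_mul, norm_toC, one_mul]; exact h2
    calc w * ‖toC (chainHol sq cb U n) * ψ x₂ - ψ x₁‖ ≤ ‖toC (chainHol sq cb U n) * ψ x₂ - ψ x₁‖ :=
          mul_le_of_le_one_left (norm_nonneg _) hw1
      _ ≤ P.spacing k ^ 2 * (m * (c₃ * Ex * F)) + P.spacing k ^ 2 * (m * (c₃ * Ex * F)) := hsub
      _ = P.spacing k ^ 2 * ((2 * c₃) * m * 1 * Ex * F) := by ring
      _ ≤ P.spacing k ^ 2 * (C * m * br * Ex * F) := by
          refine mul_le_mul_of_nonneg_left ?_ (sq_nonneg _)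
          exact mul_le_mul_of_nonneg_right (mul_le_mul_of_nonneg_right
            (mul_le_mul (mul_le_mul_of_nonneg_right hCb hm0) hbr1 zero_le_one (by positivity)) hE0.le) hF0

end Holder

/-! ## §4 The members for p13's cut-off of record `ζ″ = σ((R₀ − |·|_T)/(R₀ − R₁))` of (2.29) and r18's smooth product cut-off -/

section Instances

open BIJ88Cutoffs21 (cutoff)
open BIJ88LocDeriv230ZetaPiFlatTorus (zetaPi_zero_eq_zero_of_le abs_zetaPi_zero_le_one abs_zetaPi_zero_shift_sub_le)
open BIJ88HkLocHolderTorus (zetaPi)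
open Literature.Analysis.Calculus (exists_abs_deriv_and_deriv_deriv_smoothTransition_le)

/-- **THE COVARIANT-DERIVATIVE MEMBER OF (2.30) AT NON-FLAT SMALL FIELDS, OPERATOR FORM, `k`-UNIFORM, FOR THE PRINTED LOCALIZATION DATA OF
RECORD** (gen 26's torus cubes `{□_α}`, weights `λ_α` of (2.27), p13's cut-off of (2.29)): constants from `(d, L, a)` and gen 27's universal
`K_σ`; for all data as in `deriv230_smallField_op_of_lipschitz`,
`‖(D_uG_{k,loc}(u)f)(⟨x, x+e_μ⟩)‖ ≤ (L^kε)·C·m·(1 + L^k((R₀ − R₁)⁻¹ + s⁻¹))·e^{−t₀ dist(suppt f, x)/L^k}·‖f‖_∞` — print's (2.30)-analogue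
*"for covariant derivatives … of G_{k,loc}(u)"* at the non-flat small fields of p. 263, in print's `‖f‖_∞` form.
[cite: BalabanImbrieJaffe1988, (2.30) p.263] -/
theorem deriv230_smallField_op_cwt (d L : ℕ) (hd1 : 1 ≤ d) (hd3 : d + 1 ≤ 3) (hL : Odd L ∧ 1 < L) {a : ℝ} (ha : 0 < a) :
    ∃ t₀ C : ℝ, 0 < t₀ ∧ 0 < C ∧ ∀ (P : Params) (hPd : P.d = d + 1), P.L = L →
      ∀ k : ℕ, 1 ≤ k → k ≤ P.K → ∀ (c M0 : Fin (d + 1) → ℕ), (∀ i, 1 ≤ M0 i) →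
        (∀ i, c i * P.L ^ k + P.L ^ k * M0 i ≤ P.sitesPerDir 0) → (∀ i, P.L ^ k * M0 i < P.sitesPerDir 0) →
      ∀ (s W : ℕ), 1 ≤ s → ∀ (R R₀ R₁ : ℝ), (P.L : ℝ) ^ k + 1 ≤ R → 0 ≤ R₁ → R₁ < R₀ → (P.L : ℝ) ^ k ≤ R₀ →
        2 * (s : ℝ) / 3 + R₀ / 2 + R ≤ W → (∀ i, ((P.L ^ k * M0 i : ℕ) : ℝ) + R ≤ P.sitesPerDir 0) →
      ∀ (U : GaugeField P 0 U1) (θp Tu δ : ℝ), 0 ≤ θp →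
        (∀ p : Balaban1983to89.Plaq P 0, ‖toC (GaugeField.plaqHol U p) - 1‖ ≤ θp) →
        2 * (P.d : ℝ) ^ 3 * (((P.L : ℝ) ^ k) ^ 2 * θp) ^ 2 ≤ 1 →
        (∀ b ∈ starB (cubeT hPd (P.L ^ k) c fun i => P.L ^ k * M0 i), blkIter k b.src = blkIter k b.tgt → ‖toC (U b) - 1‖ ≤ Tu) →
        (∀ x ∈ (cubeT hPd (P.L ^ k) c fun i => P.L ^ k * M0 i), ‖holCK U k x - 1‖ ≤ δ) →
        2 * (((P.L : ℝ) ^ k - 1) * (P.L : ℝ) ^ k) * P.d * Tu ^ 2 + 2 * δ ^ 2 ≤ 1 / 2 →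
      ∀ (x : Balaban1983to89.Site P 0) (μ : Fin P.d),
        x ∈ (cubeT hPd (P.L ^ k) c fun i => P.L ^ k * M0 i) →
        (∀ i, R₀ ≤ (boxCoord hPd (P.L ^ k) c x i : ℝ) ∧ (boxCoord hPd (P.L ^ k) c x i : ℝ) + R₀ ≤ (P.L ^ k * M0 i : ℕ) - 1) →
        x.shift μ ∈ (cubeT hPd (P.L ^ k) c fun i => P.L ^ k * M0 i) →
        (∀ i, R₀ ≤ (boxCoord hPd (P.L ^ k) c (x.shift μ) i : ℝ) ∧
          (boxCoord hPd (P.L ^ k) c (x.shift μ) i : ℝ) + R₀ ≤ (P.L ^ k * M0 i : ℕ) - 1) →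
      ∀ (f : Balaban1983to89.Site P 0 → ℂ) (F D : ℝ), (∀ y, ‖f y‖ ≤ F) → 0 ≤ D → (∀ y, f y ≠ 0 → D ≤ B5Ineq137Torus.T P 0 x y) →
        ‖covD P.eps⁻¹ (cfg U)
            (gLocT (B1RG242Torus.α P a k * (P.L : ℝ) ^ (k * P.d)) P.eps⁻¹ U k (cubeFam hPd (P.L ^ k) c M0 s W)
              (lamFam hPd (P.L ^ k) c M0 s) (cutoff R₁ R₀ (B5Ineq137Torus.T P 0)) *ᵥ f) ⟨x, μ⟩‖ ≤
          P.spacing k * (C * (⌊(((P.L : ℝ) ^ k) - 1 + R₀) / s⌋₊ + 3) ^ (d + 1) *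
            (1 + (P.L : ℝ) ^ k * ((R₀ - R₁)⁻¹ + (s : ℝ)⁻¹)) * Real.exp (-(t₀ * (((P.L : ℝ) ^ k)⁻¹ * D))) * F) := by
  obtain ⟨K, hK0, hK⟩ := exists_abs_cutoff_sub_le.{0, 0}
  obtain ⟨t₀, C, ht₀, hC, H⟩ := deriv230_smallField_op_of_lipschitz d L hd1 hd3 hL ha hK0
  refine ⟨t₀, C, ht₀, hC, ?_⟩
  intro P hPd hPL k hk1 hkK c M0 hM0 hfit0 hN0 s W hs R R₀ R₁ hR hR₁ hR10 hLR₀ hW hgap U θp Tu δ hθp0 hplaq hθps hInt hTree hsmall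
    x μ hx hdeep hxe hdeepe f F D hF hD hsupp
  obtain ⟨h1, h2, h3⟩ := cutoff_hyps (hK R₁ R₀ hR10 (B5Ineq137Torus.T P 0)) hK0 hR10
  exact H P hPd hPL k hk1 hkK c M0 hM0 hfit0 hN0 s W hs R R₀ R₁ hR hR₁ hR10 hLR₀ hW hgap _ h1 h2 h3 U θp Tu δ hθp0 hplaq hθps hInt hTree
    hsmall x μ hx hdeep hxe hdeepe f F D hF hD hsupp

/-- **THE SAME FOR THE SMOOTH PRODUCT CUT-OFF `ζ″ = ζ^Π(R₁, R₀)`** (r18's `zetaPi`; gen 28's scale-0 facts, the tree's universal `C_σ`).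
[cite: BalabanImbrieJaffe1988, (2.30) p.263] -/
theorem deriv230_smallField_op_zetaPi (d L : ℕ) (hd1 : 1 ≤ d) (hd3 : d + 1 ≤ 3) (hL : Odd L ∧ 1 < L) {a : ℝ} (ha : 0 < a) :
    ∃ t₀ C : ℝ, 0 < t₀ ∧ 0 < C ∧ ∀ (P : Params) (hPd : P.d = d + 1), P.L = L →
      ∀ k : ℕ, 1 ≤ k → k ≤ P.K → ∀ (c M0 : Fin (d + 1) → ℕ), (∀ i, 1 ≤ M0 i) →
        (∀ i, c i * P.L ^ k + P.L ^ k * M0 i ≤ P.sitesPerDir 0) → (∀ i, P.L ^ k * M0 i < P.sitesPerDir 0) →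
      ∀ (s W : ℕ), 1 ≤ s → ∀ (R R₀ R₁ : ℝ), (P.L : ℝ) ^ k + 1 ≤ R → 0 ≤ R₁ → R₁ < R₀ → (P.L : ℝ) ^ k ≤ R₀ →
        2 * (s : ℝ) / 3 + R₀ / 2 + R ≤ W → (∀ i, ((P.L ^ k * M0 i : ℕ) : ℝ) + R ≤ P.sitesPerDir 0) →
      ∀ (U : GaugeField P 0 U1) (θp Tu δ : ℝ), 0 ≤ θp →
        (∀ p : Balaban1983to89.Plaq P 0, ‖toC (GaugeField.plaqHol U p) - 1‖ ≤ θp) →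
        2 * (P.d : ℝ) ^ 3 * (((P.L : ℝ) ^ k) ^ 2 * θp) ^ 2 ≤ 1 →
        (∀ b ∈ starB (cubeT hPd (P.L ^ k) c fun i => P.L ^ k * M0 i), blkIter k b.src = blkIter k b.tgt → ‖toC (U b) - 1‖ ≤ Tu) →
        (∀ x ∈ (cubeT hPd (P.L ^ k) c fun i => P.L ^ k * M0 i), ‖holCK U k x - 1‖ ≤ δ) →
        2 * (((P.L : ℝ) ^ k - 1) * (P.L : ℝ) ^ k) * P.d * Tu ^ 2 + 2 * δ ^ 2 ≤ 1 / 2 →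
      ∀ (x : Balaban1983to89.Site P 0) (μ : Fin P.d),
        x ∈ (cubeT hPd (P.L ^ k) c fun i => P.L ^ k * M0 i) →
        (∀ i, R₀ ≤ (boxCoord hPd (P.L ^ k) c x i : ℝ) ∧ (boxCoord hPd (P.L ^ k) c x i : ℝ) + R₀ ≤ (P.L ^ k * M0 i : ℕ) - 1) →
        x.shift μ ∈ (cubeT hPd (P.L ^ k) c fun i => P.L ^ k * M0 i) →
        (∀ i, R₀ ≤ (boxCoord hPd (P.L ^ k) c (x.shift μ) i : ℝ) ∧
          (boxCoord hPd (P.L ^ k) c (x.shift μ) i : ℝ) + R₀ ≤ (P.L ^ k * M0 i : ℕ) - 1) →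
      ∀ (f : Balaban1983to89.Site P 0 → ℂ) (F D : ℝ), (∀ y, ‖f y‖ ≤ F) → 0 ≤ D → (∀ y, f y ≠ 0 → D ≤ B5Ineq137Torus.T P 0 x y) →
        ‖covD P.eps⁻¹ (cfg U)
            (gLocT (B1RG242Torus.α P a k * (P.L : ℝ) ^ (k * P.d)) P.eps⁻¹ U k (cubeFam hPd (P.L ^ k) c M0 s W)
              (lamFam hPd (P.L ^ k) c M0 s) (zetaPi R₁ R₀ 0) *ᵥ f) ⟨x, μ⟩‖ ≤
          P.spacing k * (C * (⌊(((P.L : ℝ) ^ k) - 1 + R₀) / s⌋₊ + 3) ^ (d + 1) *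
            (1 + (P.L : ℝ) ^ k * ((R₀ - R₁)⁻¹ + (s : ℝ)⁻¹)) * Real.exp (-(t₀ * (((P.L : ℝ) ^ k)⁻¹ * D))) * F) := by
  obtain ⟨Cσ, hC0, hC1, -⟩ := exists_abs_deriv_and_deriv_deriv_smoothTransition_le
  obtain ⟨t₀, C, ht₀, hC, H⟩ := deriv230_smallField_op_of_lipschitz d L hd1 hd3 hL ha hC0
  refine ⟨t₀, C, ht₀, hC, ?_⟩
  intro P hPd hPL k hk1 hkK c M0 hM0 hfit0 hN0 s W hs R R₀ R₁ hR hR₁ hR10 hLR₀ hW hgap U θp Tu δ hθp0 hplaq hθps hInt hTree hsmall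
    x μ hx hdeep hxe hdeepe f F D hF hD hsupp
  exact H P hPd hPL k hk1 hkK c M0 hM0 hfit0 hN0 s W hs R R₀ R₁ hR hR₁ hR10 hLR₀ hW hgap _ (abs_zetaPi_zero_le_one R₁ R₀)
    (zetaPi_zero_eq_zero_of_le hR10) (abs_zetaPi_zero_shift_sub_le hC1 hR10) U θp Tu δ hθp0 hplaq hθps hInt hTree hsmall x μ hx hdeep
    hxe hdeepe f F D hF hD hsupp

/-- **THE HÖLDER MEMBER OF ORDER `θ ≤ 1` OF (2.30) AT NON-FLAT SMALL FIELDS, OPERATOR FORM, FOR THE PRINTED DATA OF RECORD, ALONG A SHORTEST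
CONTOUR** ([6] (1.9)'s form *"Γ_{x,x′} a shortest contour connecting the points x, x′"*): constants from `(d, L, a)` and `K_σ`; for the data and
the field as in `deriv230_smallField_op_cwt`, for every pair `x₁, x₂ ∈ Ω₀` at chart depth `≥ R₀` with `|x₁ − x₂|_T ≤ R₀` THERE IS a bond chain
`Γ` from `x₁` to `x₂` of `≤ (d+1)|x₁ − x₂|_T` steps (gen 29's chart staircase) along which, for every `0 ≤ θ ≤ 1` and every `f` with
`‖f‖_∞ ≤ F` supported at sup-torus distance `≥ D ≥ 0` from both points,
`(L^k/|x₁ − x₂|_T)^θ·‖u(Γ)(G_{k,loc}(u)f)(x₂) − (G_{k,loc}(u)f)(x₁)‖ ≤ (L^kε)²·C·m·(1 + L^k((R₀ − R₁)⁻¹ + s⁻¹))·e^{−t₀D/L^k}·‖f‖_∞`.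
[cite: BalabanImbrieJaffe1988, (2.30) p.263] -/
theorem exists_contour_holder230_smallField_op_cwt (d L : ℕ) (hd1 : 1 ≤ d) (hd3 : d + 1 ≤ 3) (hL : Odd L ∧ 1 < L) {a : ℝ}
    (ha : 0 < a) :
    ∃ t₀ C : ℝ, 0 < t₀ ∧ 0 < C ∧ ∀ (P : Params) (hPd : P.d = d + 1), P.L = L →
      ∀ k : ℕ, 1 ≤ k → k ≤ P.K → ∀ (c M0 : Fin (d + 1) → ℕ), (∀ i, 1 ≤ M0 i) →
        (∀ i, c i * P.L ^ k + P.L ^ k * M0 i ≤ P.sitesPerDir 0) → (∀ i, P.L ^ k * M0 i < P.sitesPerDir 0) →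
      ∀ (s W : ℕ), 1 ≤ s → ∀ (R R₀ R₁ : ℝ), (P.L : ℝ) ^ k + 1 ≤ R → 0 ≤ R₁ → R₁ < R₀ → (P.L : ℝ) ^ k ≤ R₀ →
        2 * (s : ℝ) / 3 + R₀ / 2 + R ≤ W → (∀ i, ((P.L ^ k * M0 i : ℕ) : ℝ) + R ≤ P.sitesPerDir 0) →
      ∀ (U : GaugeField P 0 U1) (θp Tu δ : ℝ), 0 ≤ θp →
        (∀ p : Balaban1983to89.Plaq P 0, ‖toC (GaugeField.plaqHol U p) - 1‖ ≤ θp) →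
        2 * (P.d : ℝ) ^ 3 * (((P.L : ℝ) ^ k) ^ 2 * θp) ^ 2 ≤ 1 →
        (∀ b ∈ starB (cubeT hPd (P.L ^ k) c fun i => P.L ^ k * M0 i), blkIter k b.src = blkIter k b.tgt → ‖toC (U b) - 1‖ ≤ Tu) →
        (∀ x ∈ (cubeT hPd (P.L ^ k) c fun i => P.L ^ k * M0 i), ‖holCK U k x - 1‖ ≤ δ) →
        2 * (((P.L : ℝ) ^ k - 1) * (P.L : ℝ) ^ k) * P.d * Tu ^ 2 + 2 * δ ^ 2 ≤ 1 / 2 →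
      ∀ (x₁ x₂ : Balaban1983to89.Site P 0),
        x₁ ∈ (cubeT hPd (P.L ^ k) c fun i => P.L ^ k * M0 i) →
        (∀ i, R₀ ≤ (boxCoord hPd (P.L ^ k) c x₁ i : ℝ) ∧ (boxCoord hPd (P.L ^ k) c x₁ i : ℝ) + R₀ ≤ (P.L ^ k * M0 i : ℕ) - 1) →
        x₂ ∈ (cubeT hPd (P.L ^ k) c fun i => P.L ^ k * M0 i) →
        (∀ i, R₀ ≤ (boxCoord hPd (P.L ^ k) c x₂ i : ℝ) ∧ (boxCoord hPd (P.L ^ k) c x₂ i : ℝ) + R₀ ≤ (P.L ^ k * M0 i : ℕ) - 1) →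
        B5Ineq137Torus.T P 0 x₁ x₂ ≤ R₀ →
      ∃ (N : ℕ) (sq : ℕ → Balaban1983to89.Site P 0) (cb : ℕ → PBond P 0), sq 0 = x₁ ∧ sq N = x₂ ∧
        (∀ m < N, Joins (cb m) (sq m) (sq (m + 1))) ∧ (N : ℝ) ≤ ((d : ℝ) + 1) * B5Ineq137Torus.T P 0 x₁ x₂ ∧
      ∀ (θ : ℝ), 0 ≤ θ → θ ≤ 1 →
      ∀ (f : Balaban1983to89.Site P 0 → ℂ) (F D : ℝ), (∀ y, ‖f y‖ ≤ F) → 0 ≤ D →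
        (∀ y, f y ≠ 0 → D ≤ B5Ineq137Torus.T P 0 x₁ y) → (∀ y, f y ≠ 0 → D ≤ B5Ineq137Torus.T P 0 x₂ y) →
        ((P.L : ℝ) ^ k / B5Ineq137Torus.T P 0 x₁ x₂) ^ θ *
          ‖toC (chainHol sq cb U N) *
              (gLocT (B1RG242Torus.α P a k * (P.L : ℝ) ^ (k * P.d)) P.eps⁻¹ U k (cubeFam hPd (P.L ^ k) c M0 s W)
                (lamFam hPd (P.L ^ k) c M0 s) (cutoff R₁ R₀ (B5Ineq137Torus.T P 0)) *ᵥ f) x₂ -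
            (gLocT (B1RG242Torus.α P a k * (P.L : ℝ) ^ (k * P.d)) P.eps⁻¹ U k (cubeFam hPd (P.L ^ k) c M0 s W)
                (lamFam hPd (P.L ^ k) c M0 s) (cutoff R₁ R₀ (B5Ineq137Torus.T P 0)) *ᵥ f) x₁‖ ≤
          P.spacing k ^ 2 * (C * (⌊(((P.L : ℝ) ^ k) - 1 + R₀) / s⌋₊ + 3) ^ (d + 1) *
            (1 + (P.L : ℝ) ^ k * ((R₀ - R₁)⁻¹ + (s : ℝ)⁻¹)) * Real.exp (-(t₀ * (((P.L : ℝ) ^ k)⁻¹ * D))) * F) := by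
  obtain ⟨K, hK0, hK⟩ := exists_abs_cutoff_sub_le.{0, 0}
  obtain ⟨t₀, C, ht₀, hC, H⟩ := holder230_smallField_op_of_lipschitz d L hd1 hd3 hL ha hK0
  refine ⟨t₀, C, ht₀, hC, ?_⟩
  intro P hPd hPL k hk1 hkK c M0 hM0 hfit0 hN0 s W hs R R₀ R₁ hR hR₁ hR10 hLR₀ hW hgap U θp Tu δ hθp0 hplaq hθps hInt hTree hsmall
    x₁ x₂ hx₁ hdeep₁ hx₂ hdeep₂ hT
  obtain ⟨h1, h2, h3⟩ := cutoff_hyps (hK R₁ R₀ hR10 (B5Ineq137Torus.T P 0)) hK0 hR10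
  obtain ⟨N, sq, cb, h0, hN, hJ, hNle, hchain⟩ := exists_admissible_contour hPd hfit0 hx₁ hdeep₁ hx₂ hdeep₂ hT
  refine ⟨N, sq, cb, h0, hN, hJ, hNle, fun θ hθ0 hθ1 f F D hF hD hD₁ hD₂ => ?_⟩
  have hchain' : ∀ m ≤ N, sq m ∈ (cubeT hPd (P.L ^ k) c fun i => P.L ^ k * M0 i) ∧
      (∀ i, R₀ ≤ (boxCoord hPd (P.L ^ k) c (sq m) i : ℝ) ∧ (boxCoord hPd (P.L ^ k) c (sq m) i : ℝ) + R₀ ≤ (P.L ^ k * M0 i : ℕ) - 1) ∧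
      B5Ineq137Torus.T P 0 x₁ (sq m) ≤ B5Ineq137Torus.T P 0 x₁ x₂ := fun m hm => by
    obtain ⟨h1, h2, h3⟩ := hchain m hm
    exact ⟨h1, fun i => by simpa only [min_self] using h2 i, h3⟩
  exact H P hPd hPL k hk1 hkK c M0 hM0 hfit0 hN0 s W hs R R₀ R₁ hR hR₁ hR10 hLR₀ hW hgap _ h1 h2 h3 U θp Tu δ hθp0 hplaq hθps hInt
    hTree hsmall θ hθ0 hθ1 x₁ x₂ N sq cb h0 hN hJ hNle hchain' f F D hF hD hD₁ hD₂

end Instances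

/-! ## §5 (v1.1) The same members under the PRINTED plaquette smallness (7.3.1) ALONE — no gauge condition, thresholds from `(d, L^k)` only -/

section Plaquette

open BIJ88Cutoffs21 (cutoff)
open BIJ88NeumannPropagatorSmallFieldCubeDeriv (decay110_smallPlaquette_cube_deriv_uniform)
open BIJ88NeumannPropagatorSmallFieldSupDecay (decay110_smallPlaquette_cube_uniform)
open BIJ88DeltaLocClose235General (opDecay230_of_input)

/-- **THE COVARIANT-DERIVATIVE MEMBER OF (2.30) IN PRINT'S OPERATOR FORM, `k`-UNIFORM, UNDER THE PRINTED PLAQUETTE SMALLNESS ALONE, FOR THE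
TORUS CUBES AND WEIGHTS OF RECORD AND ANY LIPSCHITZ CUT-OFF** (p. 263: *"We assume that u is smooth in the □_α's … Bounds analogous to (2.30),
(2.31) hold for covariant derivatives"*; [BalabanImbrieJaffe1985] (7.3.1): *"|v(∂p) − 1| ≦ e_kμ(e_k)"* — here a fine-plaquette bound
`|u(∂p) − 1| ≤ θ` on the torus with `2(d+1)³(L^{2k}θ)² ≤ 1` and the block-scale smallness of `T ≥ d(L^k − 1)θ`, thresholds depending on
`(d, L^k)` ONLY, NO gauge condition on `u`: p34 gen 17's `decay110_smallPlaquette_cube_deriv_uniform` and p27's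
`decay110_smallPlaquette_cube_uniform` choose the gauge cube by cube).  For `d + 1 ∈ {2,3}`, `L` odd `> 1`, `a > 0`, `K ≥ 0` THERE EXIST
`t₀, C > 0` depending on `(d, L, a, K)` only such that for every volume (`P.d = d+1`, `P.L = L`), every `1 ≤ k ≤ K_P` with `2(L^k − 1) + 4 < |T|`,
the geometry of `deriv230_smallField_op_of_lipschitz` (no-wrap box `Ω₀` with torus gap `≥ R ≥ L^k + 1`, `s ≥ 1`, `W ≥ 2s/3 + R₀/2 + R`,
`0 ≤ R₁ < R₀`, `L^k ≤ R₀`), every Lipschitz cut-off, every `U(1)` field with `|u(∂p) − 1| ≤ θ` for all plaquettes, `2(d+1)³(L^{2k}θ)² ≤ 1`, every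
`T ≥ d(L^k − 1)θ` with `2(L^k−1)L^k(d+1)T² + 2((d+1)(L^k−1)T)² ≤ 1/2`, every bond with both ends in `Ω₀` at chart depth `≥ R₀`, every `f` with
`‖f‖_∞ ≤ F` supported at sup-torus distance `≥ D ≥ 0` from `x`:
`‖(D_uG_{k,loc}(u)f)(⟨x,x+e_μ⟩)‖ ≤ (L^kε)·C·m·(1 + L^k((R₀−R₁)⁻¹ + s⁻¹))·e^{−t₀D/L^k}·‖f‖_∞` — §2's proof with the two plaquette-only cube inputs.
[cite: BalabanImbrieJaffe1988, (2.30) p.263] [cite: BalabanImbrieJaffe1985, (7.3.1) p.326] -/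
theorem deriv230_smallPlaquette_op_of_lipschitz (d L : ℕ) (hd1 : 1 ≤ d) (hd3 : d + 1 ≤ 3) (hL : Odd L ∧ 1 < L) {a : ℝ} (ha : 0 < a)
    {K : ℝ} (hK0 : 0 ≤ K) :
    ∃ t₀ C : ℝ, 0 < t₀ ∧ 0 < C ∧ ∀ (P : Params) (hPd : P.d = d + 1), P.L = L →
      ∀ k : ℕ, 1 ≤ k → k ≤ P.K → 2 * (P.L ^ k - 1) + 4 < P.sitesPerDir 0 → ∀ (c M0 : Fin (d + 1) → ℕ), (∀ i, 1 ≤ M0 i) →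
        (∀ i, c i * P.L ^ k + P.L ^ k * M0 i ≤ P.sitesPerDir 0) → (∀ i, P.L ^ k * M0 i < P.sitesPerDir 0) →
      ∀ (s W : ℕ), 1 ≤ s → ∀ (R R₀ R₁ : ℝ), (P.L : ℝ) ^ k + 1 ≤ R → 0 ≤ R₁ → R₁ < R₀ → (P.L : ℝ) ^ k ≤ R₀ →
        2 * (s : ℝ) / 3 + R₀ / 2 + R ≤ W → (∀ i, ((P.L ^ k * M0 i : ℕ) : ℝ) + R ≤ P.sitesPerDir 0) →
      ∀ (ζ : Balaban1983to89.Site P 0 → Balaban1983to89.Site P 0 → ℝ), (∀ x y, |ζ x y| ≤ 1) →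
        (∀ x y, R₀ ≤ B5Ineq137Torus.T P 0 x y → ζ x y = 0) →
        (∀ (x y : Balaban1983to89.Site P 0) (ν : Fin P.d), |ζ (x.shift ν) y - ζ x y| ≤ K / (R₀ - R₁)) →
      ∀ (U : GaugeField P 0 U1) (θ : ℝ), 0 ≤ θ →
        (∀ p : Balaban1983to89.Plaq P 0, ‖toC (GaugeField.plaqHol U p) - 1‖ ≤ θ) →
        2 * (P.d : ℝ) ^ 3 * (((P.L : ℝ) ^ k) ^ 2 * θ) ^ 2 ≤ 1 →
      ∀ (T : ℝ), ((P.d - 1 : ℕ) : ℝ) * ((P.L : ℝ) ^ k - 1) * θ ≤ T →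
        2 * (((P.L : ℝ) ^ k - 1) * (P.L : ℝ) ^ k) * P.d * T ^ 2 + 2 * (P.d * ((P.L : ℝ) ^ k - 1) * T) ^ 2 ≤ 1 / 2 →
      ∀ (x : Balaban1983to89.Site P 0) (μ : Fin P.d),
        x ∈ (cubeT hPd (P.L ^ k) c fun i => P.L ^ k * M0 i) →
        (∀ i, R₀ ≤ (boxCoord hPd (P.L ^ k) c x i : ℝ) ∧ (boxCoord hPd (P.L ^ k) c x i : ℝ) + R₀ ≤ (P.L ^ k * M0 i : ℕ) - 1) →
        x.shift μ ∈ (cubeT hPd (P.L ^ k) c fun i => P.L ^ k * M0 i) →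
        (∀ i, R₀ ≤ (boxCoord hPd (P.L ^ k) c (x.shift μ) i : ℝ) ∧
          (boxCoord hPd (P.L ^ k) c (x.shift μ) i : ℝ) + R₀ ≤ (P.L ^ k * M0 i : ℕ) - 1) →
      ∀ (f : Balaban1983to89.Site P 0 → ℂ) (F D : ℝ), (∀ y, ‖f y‖ ≤ F) → 0 ≤ D → (∀ y, f y ≠ 0 → D ≤ B5Ineq137Torus.T P 0 x y) →
        ‖covD P.eps⁻¹ (cfg U)
            (gLocT (B1RG242Torus.α P a k * (P.L : ℝ) ^ (k * P.d)) P.eps⁻¹ U k (cubeFam hPd (P.L ^ k) c M0 s W)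
              (lamFam hPd (P.L ^ k) c M0 s) ζ *ᵥ f) ⟨x, μ⟩‖ ≤
          P.spacing k * (C * (⌊(((P.L : ℝ) ^ k) - 1 + R₀) / s⌋₊ + 3) ^ (d + 1) *
            (1 + (P.L : ℝ) ^ k * ((R₀ - R₁)⁻¹ + (s : ℝ)⁻¹)) * Real.exp (-(t₀ * (((P.L : ℝ) ^ k)⁻¹ * D))) * F) := by
  obtain ⟨t₁, c₁, ht₁, hc₁, H1⟩ := decay110_smallPlaquette_cube_deriv_uniform d L hd1 hd3 hL ha
  obtain ⟨t₂, c₂, ht₂, hc₂, H2⟩ := decay110_smallPlaquette_cube_uniform d (L - 1) hd3 (by omega) ha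
  set Λ₀ : ℝ := max K (3 * Real.pi * (d + 1 : ℕ) / 2) with hΛ₀def
  have hΛ₀0 : 0 ≤ Λ₀ := hK0.trans (le_max_left _ _)
  refine ⟨min t₁ t₂, max c₁ (2 * c₂ * Λ₀ + 1), lt_min ht₁ ht₂, lt_max_of_lt_left hc₁, ?_⟩
  intro P hPd hPL k hk1 hkK hRsz c M0 hM0 hfit0 hN0 s W hs R R₀ R₁ hR hR₁ hR10 hLR₀ hW hgap ζ hζabs hζ0 hζlip U θ hθ0 hplaq hθs T hT hsmallT
    x μ hx hdeep hxe hdeepe f F D hF hD hsupp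
  have hPL' : P.L = L - 1 + 1 := by omega
  set t := min t₁ t₂ with htdef
  set C := max c₁ (2 * c₂ * Λ₀ + 1) with hCdef
  have hδ1 : t ≤ t₁ := min_le_left _ _
  have hδ2 : t ≤ t₂ := min_le_right _ _
  have hC1 : c₁ ≤ C := le_max_left _ _
  have hC2 : 2 * c₂ * Λ₀ + 1 ≤ C := le_max_right _ _
  have hC0 : 0 ≤ C := hc₁.le.trans hC1
  have hn : 1 ≤ P.L ^ k := Nat.one_le_pow _ _ P.L_pos
  have hk : 0 + k ≤ P.m + P.K := by omega
  have hkmK : k ≤ P.m + P.K := by omega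
  have hLpos : (0 : ℝ) < P.L := P.cast_L_pos
  have hLk : (0 : ℝ) < (P.L : ℝ) ^ k := pow_pos hLpos _
  have hR1 : 1 < R := by
    have hLk1 : (1 : ℝ) ≤ (P.L : ℝ) ^ k := by exact_mod_cast hn
    linarith
  have hR0 : 0 ≤ R := zero_le_one.trans hR1.le
  have hR₀ : 0 ≤ R₀ := hR₁.trans hR10.le
  have hs0 : 0 < s := hs
  have hsr : (0 : ℝ) < s := by exact_mod_cast hs0
  have hgap' : 0 < R₀ - R₁ := sub_pos.2 hR10
  have hε : 0 < ((P.L : ℝ) ^ k)⁻¹ := inv_pos.mpr hLk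
  have hF0 : 0 ≤ F := (norm_nonneg _).trans (hF x)
  have hsp0 : 0 < P.spacing k := P.spacing_pos k
  have heps : 0 < P.eps := P.eps_pos
  -- abbreviations
  set Ω₀ : Finset (Balaban1983to89.Site P 0) := cubeT hPd (P.L ^ k) c fun i => P.L ^ k * M0 i with hΩ₀def
  set A : ℝ := B1RG242Torus.α P a k * (P.L : ℝ) ^ (k * P.d) with hAdef
  set x' := x.shift μ with hx'def
  set m : ℝ := ((⌊(((P.L : ℝ) ^ k) - 1 + R₀) / s⌋₊ : ℝ) + 3) ^ (d + 1) with hmdef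
  have hm0 : 0 ≤ m := by rw [hmdef]; positivity
  set E : ℝ := Real.exp (-(t * (((P.L : ℝ) ^ k)⁻¹ * D))) with hEdef
  have hE0 : 0 < E := Real.exp_pos _
  have hεD : 0 ≤ ((P.L : ℝ) ^ k)⁻¹ * D := mul_nonneg hε.le hD
  have hE1 : Real.exp (-(t₁ * D / (P.L : ℝ) ^ k)) ≤ E := exp_div_le hδ1 hLk hD
  have hE2 : Real.exp (-(t₂ * (((P.L : ℝ) ^ k)⁻¹ * D))) ≤ E := Real.exp_le_exp.2 (by nlinarith)
  -- the support of the sources in p34's `supDist` form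
  have hsuppN : ∀ (g : Balaban1983to89.Site P 0 → ℂ), (∀ y, g y ≠ 0 → f y ≠ 0) → ∀ z, g z ≠ 0 → D ≤ (supDist x z : ℝ) := by
    intro g hg z hz
    rw [← T_eq_supDist P x z]
    exact hsupp z (hg z hz)
  -- the sources
  set g' : ↥(labels (P.L ^ k) M0 s) → Balaban1983to89.Site P 0 → ℂ :=
    fun α y => (ζ x' y : ℂ) * (lamFam hPd (P.L ^ k) c M0 s α x' y : ℂ) * f y with hg'def
  set dg : ↥(labels (P.L ^ k) M0 s) → Balaban1983to89.Site P 0 → ℂ :=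
    fun α y => ((ζ x' y : ℂ) * (lamFam hPd (P.L ^ k) c M0 s α x' y : ℂ) - (ζ x y : ℂ) * (lamFam hPd (P.L ^ k) c M0 s α x y : ℂ)) * f y
    with hdgdef
  -- the identity (sources folded)
  have hid : covD P.eps⁻¹ (cfg U) (gLocT A P.eps⁻¹ U k (cubeFam hPd (P.L ^ k) c M0 s W) (lamFam hPd (P.L ^ k) c M0 s) ζ *ᵥ f) ⟨x, μ⟩ =
      ∑ α, covD P.eps⁻¹ (cfg U) (gBox A P.eps⁻¹ U k (cubeFam hPd (P.L ^ k) c M0 s W α) *ᵥ g' α) ⟨x, μ⟩ +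
      ∑ α, ((P.eps⁻¹ : ℝ) : ℂ) * (gBox A P.eps⁻¹ U k (cubeFam hPd (P.L ^ k) c M0 s W α) *ᵥ dg α) x :=
    covD_gLocT_apply P.eps⁻¹ (cfg U) A P.eps⁻¹ U k (cubeFam hPd (P.L ^ k) c M0 s W) (lamFam hPd (P.L ^ k) c M0 s) ζ f ⟨x, μ⟩
  rw [hid]
  -- the active-label sets of the two endpoints
  set Sx : Finset ↥(labels (P.L ^ k) M0 s) := (activeLabels hPd (P.L ^ k) c s R₀ (blkIter k x)).subtype fun α => α ∈ labels (P.L ^ k) M0 s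
    with hSxdef
  set Sx' : Finset ↥(labels (P.L ^ k) M0 s) := (activeLabels hPd (P.L ^ k) c s R₀ (blkIter k x')).subtype fun α => α ∈ labels (P.L ^ k) M0 s
    with hSx'def
  have hcardx : (Sx.card : ℝ) ≤ m := by
    have h1 := card_subtype_activeLabels_le (hPd := hPd) (c := c) (M0 := M0) hn hs0 hR₀ (blkIter k x)
    have e : (((P.L ^ k : ℕ) : ℕ) : ℝ) = (P.L : ℝ) ^ k := by push_cast; rfl
    rw [hSxdef, hmdef]; rw [e] at h1; exact h1
  have hcardx' : (Sx'.card : ℝ) ≤ m := by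
    have h1 := card_subtype_activeLabels_le (hPd := hPd) (c := c) (M0 := M0) hn hs0 hR₀ (blkIter k x')
    have e : (((P.L ^ k : ℕ) : ℕ) : ℝ) = (P.L : ℝ) ^ k := by push_cast; rfl
    rw [hSx'def, hmdef]; rw [e] at h1; exact h1
  have hSx : ∀ (α : ↥(labels (P.L ^ k) M0 s)) (y : Balaban1983to89.Site P 0),
      ζ x y * lamFam hPd (P.L ^ k) c M0 s α x y ≠ 0 → α ∈ Sx := by
    intro α y hne
    rw [hSxdef, Finset.mem_subtype]
    exact mem_activeLabels_of_ne_zero_of_deep hk hs0 hfit0 hζ0 (mem_blockK_blkIter x) hdeep hne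
  have hSx' : ∀ (α : ↥(labels (P.L ^ k) M0 s)) (y : Balaban1983to89.Site P 0),
      ζ x' y * lamFam hPd (P.L ^ k) c M0 s α x' y ≠ 0 → α ∈ Sx' := by
    intro α y hne
    rw [hSx'def, Finset.mem_subtype]
    exact mem_activeLabels_of_ne_zero_of_deep hk hs0 hfit0 hζ0 (mem_blockK_blkIter x') hdeepe hne
  -- TERM 1: p34's plaquette-only derivative member for the cubes active at `x'`
  set B₁ : ℝ := c₁ * P.spacing k * E * F with hB₁def
  have hB₁0 : 0 ≤ B₁ := by positivity
  have hterm1 : ∀ α, ‖covD P.eps⁻¹ (cfg U) (gBox A P.eps⁻¹ U k (cubeFam hPd (P.L ^ k) c M0 s W α) *ᵥ g' α) ⟨x, μ⟩‖ ≤ B₁ := by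
    intro α
    by_cases hex : ∃ y, ζ x' y * lamFam hPd (P.L ^ k) c M0 s α x' y ≠ 0
    · obtain ⟨y₀, hy₀⟩ := hex
      obtain ⟨-, -, hfar⟩ := rowHyp_ii hPd hn hs0 hfit0 hR0 hgap hW hζ0 hxe hdeepe α y₀ hy₀
      have hdepth : ∀ w, w ∉ cubeFam hPd (P.L ^ k) c M0 s W α → P.L ^ k ≤ supDist x w := by
        intro w hw
        have h1 : ((P.L : ℝ) ^ k) ≤ B5Ineq137Torus.T P 0 x w :=
          depth_of_active hPd hfit0 hR hLR₀ hdeep (fun w hw' hwn => (hfar w hw' hwn).1) hw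
        rw [T_eq_supDist P x w] at h1
        exact_mod_cast h1
      obtain ⟨c', M', hM', hfit', hN', hcα⟩ := cubeFam_fits (hPd := hPd) (s := s) (W := W) hM0 hfit0 hN0 α
      rw [hcα] at hdepth ⊢
      refine (H1 P hPd hPL k hk1 hkK hRsz U θ hθ0 hplaq hθs T hT hsmallT c' M' hM' hfit' hN' x μ (g' α) F D
        (fun y => norm_rowSource_le (hζabs x' y) (abs_lam_le_one (sum_abs_lamT_le_one hfit0) α x' y) hF y)
        (hsuppN (g' α) fun y hy => (rowSource_ne_zero hy).2) hdepth).trans ?_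
      rw [hB₁def]
      exact mul_le_mul_of_nonneg_right (mul_le_mul_of_nonneg_left hE1 (by positivity)) hF0
    · push Not at hex
      have h0 : g' α = 0 := by
        funext y; rw [hg'def]; dsimp only; rw [← Complex.ofReal_mul, hex y, Complex.ofReal_zero, zero_mul]; rfl
      rw [h0, mulVec_zero]
      simp only [covD, Pi.zero_apply, mul_zero, sub_zero, norm_zero]
      exact hB₁0
  have hzero1 : ∀ α, α ∉ Sx' → covD P.eps⁻¹ (cfg U) (gBox A P.eps⁻¹ U k (cubeFam hPd (P.L ^ k) c M0 s W α) *ᵥ g' α) ⟨x, μ⟩ = 0 := by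
    intro α hα
    have h0 : g' α = 0 := by
      funext y
      by_contra hne
      exact hα (hSx' α y (rowSource_ne_zero hne).1)
    rw [h0, mulVec_zero]
    simp only [covD, Pi.zero_apply, mul_zero, sub_zero]
  have hsum1 : ‖∑ α, covD P.eps⁻¹ (cfg U) (gBox A P.eps⁻¹ U k (cubeFam hPd (P.L ^ k) c M0 s W α) *ᵥ g' α) ⟨x, μ⟩‖ ≤ m * B₁ := by
    rw [← Finset.sum_subset (Finset.subset_univ Sx') (fun α _ hα => hzero1 α hα)]
    calc ‖∑ α ∈ Sx', covD P.eps⁻¹ (cfg U) (gBox A P.eps⁻¹ U k (cubeFam hPd (P.L ^ k) c M0 s W α) *ᵥ g' α) ⟨x, μ⟩‖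
        ≤ ∑ α ∈ Sx', ‖covD P.eps⁻¹ (cfg U) (gBox A P.eps⁻¹ U k (cubeFam hPd (P.L ^ k) c M0 s W α) *ᵥ g' α) ⟨x, μ⟩‖ := norm_sum_le _ _
      _ ≤ ∑ α ∈ Sx', B₁ := Finset.sum_le_sum fun α _ => hterm1 α
      _ = Sx'.card * B₁ := by rw [Finset.sum_const, nsmul_eq_mul]
      _ ≤ m * B₁ := mul_le_mul_of_nonneg_right hcardx' hB₁0
  -- TERM 2: p27's plaquette-only value member on the difference sources, for the cubes active at `x` or `x'`
  set Λ : ℝ := K / (R₀ - R₁) + 3 * Real.pi * (d + 1 : ℕ) / (2 * s) with hΛdef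
  have hΛ0 : 0 ≤ Λ := by rw [hΛdef]; positivity
  set B₂ : ℝ := c₂ * P.spacing k ^ 2 * E * (Λ * F) with hB₂def
  have hB₂0 : 0 ≤ B₂ := by positivity
  have hterm2 : ∀ α, ‖(gBox A P.eps⁻¹ U k (cubeFam hPd (P.L ^ k) c M0 s W α) *ᵥ dg α) x‖ ≤ B₂ := by
    intro α
    obtain ⟨c', M', hM', hfit', hN', hcα⟩ := cubeFam_fits (hPd := hPd) (s := s) (W := W) hM0 hfit0 hN0 α
    rw [hcα]
    refine (H2 P hPd hPL' k hk1 hkmK hRsz U θ hθ0 hplaq T hT hsmallT c' M' hM' hfit' hN' x (dg α) (Λ * F) D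
      (fun y => norm_rowSource_sub_le_of_lipschitz hPd hs0 hfit0 hN0 (div_nonneg hK0 hgap'.le) hζabs (fun y => hζlip x y μ) α.1 hx hxe
        hF y)
      (fun y hy => hsupp y (right_ne_zero_of_mul hy))).trans ?_
    rw [hB₂def]
    calc P.spacing k ^ 2 * (c₂ * Real.exp (-(t₂ * (((P.L : ℝ) ^ k)⁻¹ * D))) * (Λ * F))
        ≤ P.spacing k ^ 2 * (c₂ * E * (Λ * F)) :=
          mul_le_mul_of_nonneg_left (mul_le_mul_of_nonneg_right (mul_le_mul_of_nonneg_left hE2 hc₂.le) (by positivity)) (sq_nonneg _)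
      _ = c₂ * P.spacing k ^ 2 * E * (Λ * F) := by ring
  have hzero2 : ∀ α, α ∉ Sx ∪ Sx' → (gBox A P.eps⁻¹ U k (cubeFam hPd (P.L ^ k) c M0 s W α) *ᵥ dg α) x = 0 := by
    intro α hα
    rw [Finset.mem_union, not_or] at hα
    have h0 : dg α = 0 := by
      funext y
      rw [hdgdef]; dsimp only
      have h1 : ζ x' y * lamFam hPd (P.L ^ k) c M0 s α x' y = 0 := by
        by_contra hne; exact hα.2 (hSx' α y hne)
      have h2 : ζ x y * lamFam hPd (P.L ^ k) c M0 s α x y = 0 := by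
        by_contra hne; exact hα.1 (hSx α y hne)
      rw [← Complex.ofReal_mul, ← Complex.ofReal_mul, h1, h2]; simp
    rw [h0, mulVec_zero, Pi.zero_apply]
  have hcardU : ((Sx ∪ Sx').card : ℝ) ≤ 2 * m := by
    have h1 : ((Sx ∪ Sx').card : ℝ) ≤ (Sx.card : ℝ) + (Sx'.card : ℝ) := by exact_mod_cast Finset.card_union_le _ _
    linarith
  have hsum2 : ‖∑ α, ((P.eps⁻¹ : ℝ) : ℂ) * (gBox A P.eps⁻¹ U k (cubeFam hPd (P.L ^ k) c M0 s W α) *ᵥ dg α) x‖ ≤ P.eps⁻¹ * (2 * m * B₂) := by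
    rw [← Finset.mul_sum, norm_mul, Complex.norm_real, Real.norm_eq_abs, abs_of_pos (inv_pos.mpr heps)]
    refine mul_le_mul_of_nonneg_left ?_ (inv_pos.mpr heps).le
    rw [← Finset.sum_subset (Finset.subset_univ (Sx ∪ Sx')) (fun α _ hα => hzero2 α hα)]
    calc ‖∑ α ∈ Sx ∪ Sx', (gBox A P.eps⁻¹ U k (cubeFam hPd (P.L ^ k) c M0 s W α) *ᵥ dg α) x‖
        ≤ ∑ α ∈ Sx ∪ Sx', ‖(gBox A P.eps⁻¹ U k (cubeFam hPd (P.L ^ k) c M0 s W α) *ᵥ dg α) x‖ := norm_sum_le _ _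
      _ ≤ ∑ α ∈ Sx ∪ Sx', B₂ := Finset.sum_le_sum fun α _ => hterm2 α
      _ = (Sx ∪ Sx').card * B₂ := by rw [Finset.sum_const, nsmul_eq_mul]
      _ ≤ 2 * m * B₂ := mul_le_mul_of_nonneg_right hcardU hB₂0
  -- assembling
  have hscale : P.eps⁻¹ * P.spacing k ^ 2 = P.spacing k * (P.L : ℝ) ^ k := by
    rw [Params.spacing]
    field_simp
  have hΛle : Λ ≤ Λ₀ * ((R₀ - R₁)⁻¹ + (s : ℝ)⁻¹) := by
    rw [hΛdef, mul_add]
    refine add_le_add ?_ ?_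
    · rw [div_eq_mul_inv]
      exact mul_le_mul_of_nonneg_right (le_max_left _ _) (inv_pos.mpr hgap').le
    · have e : 3 * Real.pi * (d + 1 : ℕ) / (2 * s) = (3 * Real.pi * (d + 1 : ℕ) / 2) * (s : ℝ)⁻¹ := by
        field_simp
      rw [e]
      exact mul_le_mul_of_nonneg_right (le_max_right _ _) (inv_pos.mpr hsr).le
  have h1 : m * B₁ ≤ P.spacing k * (C * m * 1 * E * F) := by
    have : B₁ ≤ P.spacing k * (C * E * F) := by
      rw [hB₁def]
      calc c₁ * P.spacing k * E * F = P.spacing k * (c₁ * E * F) := by ring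
        _ ≤ P.spacing k * (C * E * F) :=
            mul_le_mul_of_nonneg_left (mul_le_mul_of_nonneg_right (mul_le_mul_of_nonneg_right hC1 hE0.le) hF0) hsp0.le
    calc m * B₁ ≤ m * (P.spacing k * (C * E * F)) := mul_le_mul_of_nonneg_left this hm0
      _ = P.spacing k * (C * m * 1 * E * F) := by ring
  have h2 : P.eps⁻¹ * (2 * m * B₂) ≤ P.spacing k * (C * m * ((P.L : ℝ) ^ k * ((R₀ - R₁)⁻¹ + (s : ℝ)⁻¹)) * E * F) := by
    have e : P.eps⁻¹ * (2 * m * B₂) = P.spacing k * ((2 * c₂ * Λ) * m * (P.L : ℝ) ^ k * E * F) := by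
      rw [hB₂def]
      have : P.eps⁻¹ * (2 * m * (c₂ * P.spacing k ^ 2 * E * (Λ * F))) =
          (P.eps⁻¹ * P.spacing k ^ 2) * (2 * c₂ * Λ * m * E * F) := by ring
      rw [this, hscale]; ring
    rw [e]
    refine mul_le_mul_of_nonneg_left ?_ hsp0.le
    have hcoef : 2 * c₂ * Λ * m * (P.L : ℝ) ^ k ≤ C * m * ((P.L : ℝ) ^ k * ((R₀ - R₁)⁻¹ + (s : ℝ)⁻¹)) := by
      have h3 : 2 * c₂ * Λ ≤ C * ((R₀ - R₁)⁻¹ + (s : ℝ)⁻¹) := by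
        calc 2 * c₂ * Λ ≤ 2 * c₂ * (Λ₀ * ((R₀ - R₁)⁻¹ + (s : ℝ)⁻¹)) := mul_le_mul_of_nonneg_left hΛle (by positivity)
          _ = (2 * c₂ * Λ₀) * ((R₀ - R₁)⁻¹ + (s : ℝ)⁻¹) := by ring
          _ ≤ C * ((R₀ - R₁)⁻¹ + (s : ℝ)⁻¹) :=
              mul_le_mul_of_nonneg_right (by linarith) (by positivity)
      calc 2 * c₂ * Λ * m * (P.L : ℝ) ^ k = (2 * c₂ * Λ) * (m * (P.L : ℝ) ^ k) := by ring
        _ ≤ (C * ((R₀ - R₁)⁻¹ + (s : ℝ)⁻¹)) * (m * (P.L : ℝ) ^ k) := mul_le_mul_of_nonneg_right h3 (by positivity)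
        _ = C * m * ((P.L : ℝ) ^ k * ((R₀ - R₁)⁻¹ + (s : ℝ)⁻¹)) := by ring
    exact mul_le_mul_of_nonneg_right (mul_le_mul_of_nonneg_right hcoef hE0.le) hF0
  refine ((norm_add_le _ _).trans (add_le_add hsum1 hsum2)).trans ?_
  calc m * B₁ + P.eps⁻¹ * (2 * m * B₂)
      ≤ P.spacing k * (C * m * 1 * E * F) + P.spacing k * (C * m * ((P.L : ℝ) ^ k * ((R₀ - R₁)⁻¹ + (s : ℝ)⁻¹)) * E * F) :=
        add_le_add h1 h2
    _ = P.spacing k * (C * m * (1 + (P.L : ℝ) ^ k * ((R₀ - R₁)⁻¹ + (s : ℝ)⁻¹)) * E * F) := by ring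

set_option maxHeartbeats 400000 in
/-- **THE HÖLDER MEMBER OF ORDER `θ ≤ 1` OF (2.30) IN PRINT'S OPERATOR FORM, `k`-UNIFORM, UNDER THE PRINTED PLAQUETTE SMALLNESS ALONE, ALONG
EVERY ADMISSIBLE CONTOUR**: with the data and hypotheses of `deriv230_smallPlaquette_op_of_lipschitz`, for every `0 ≤ θ' ≤ 1`, every pair
`x₁, x₂` joined by an admissible bond chain (sites in `Ω₀` at chart depth `≥ R₀`, within `|x₁ − x₂|_T` of `x₁`, `≤ (d+1)|x₁ − x₂|_T` steps) and
every `f` with `‖f‖_∞ ≤ F` supported at sup-torus distance `≥ D ≥ 0` from both points: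
`(L^k/|x₁ − x₂|_T)^{θ'}·‖u(Γ)(G_{k,loc}(u)f)(x₂) − (G_{k,loc}(u)f)(x₁)‖ ≤ (L^kε)²·C·m·(1 + L^k((R₀ − R₁)⁻¹ + s⁻¹))·e^{−t₀D/L^k}·‖f‖_∞` — §3's
proof with the plaquette-only inputs (near pairs: the member above telescoped by gen 29's `norm_transport_sub_le_sum_covD`; far pairs: p31's
`opDecay230_of_input` fed with p27's `decay110_smallPlaquette_cube_uniform` cube by cube).
[cite: BalabanImbrieJaffe1988, (2.30) p.263] [cite: BalabanImbrieJaffe1985, (7.3.1) p.326] -/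
theorem holder230_smallPlaquette_op_of_lipschitz (d L : ℕ) (hd1 : 1 ≤ d) (hd3 : d + 1 ≤ 3) (hL : Odd L ∧ 1 < L) {a : ℝ} (ha : 0 < a)
    {K : ℝ} (hK0 : 0 ≤ K) :
    ∃ t₀ C : ℝ, 0 < t₀ ∧ 0 < C ∧ ∀ (P : Params) (hPd : P.d = d + 1), P.L = L →
      ∀ k : ℕ, 1 ≤ k → k ≤ P.K → 2 * (P.L ^ k - 1) + 4 < P.sitesPerDir 0 → ∀ (c M0 : Fin (d + 1) → ℕ), (∀ i, 1 ≤ M0 i) →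
        (∀ i, c i * P.L ^ k + P.L ^ k * M0 i ≤ P.sitesPerDir 0) → (∀ i, P.L ^ k * M0 i < P.sitesPerDir 0) →
      ∀ (s W : ℕ), 1 ≤ s → ∀ (R R₀ R₁ : ℝ), (P.L : ℝ) ^ k + 1 ≤ R → 0 ≤ R₁ → R₁ < R₀ → (P.L : ℝ) ^ k ≤ R₀ →
        2 * (s : ℝ) / 3 + R₀ / 2 + R ≤ W → (∀ i, ((P.L ^ k * M0 i : ℕ) : ℝ) + R ≤ P.sitesPerDir 0) →
      ∀ (ζ : Balaban1983to89.Site P 0 → Balaban1983to89.Site P 0 → ℝ), (∀ x y, |ζ x y| ≤ 1) →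
        (∀ x y, R₀ ≤ B5Ineq137Torus.T P 0 x y → ζ x y = 0) →
        (∀ (x y : Balaban1983to89.Site P 0) (ν : Fin P.d), |ζ (x.shift ν) y - ζ x y| ≤ K / (R₀ - R₁)) →
      ∀ (U : GaugeField P 0 U1) (θ : ℝ), 0 ≤ θ →
        (∀ p : Balaban1983to89.Plaq P 0, ‖toC (GaugeField.plaqHol U p) - 1‖ ≤ θ) →
        2 * (P.d : ℝ) ^ 3 * (((P.L : ℝ) ^ k) ^ 2 * θ) ^ 2 ≤ 1 →
      ∀ (T : ℝ), ((P.d - 1 : ℕ) : ℝ) * ((P.L : ℝ) ^ k - 1) * θ ≤ T →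
        2 * (((P.L : ℝ) ^ k - 1) * (P.L : ℝ) ^ k) * P.d * T ^ 2 + 2 * (P.d * ((P.L : ℝ) ^ k - 1) * T) ^ 2 ≤ 1 / 2 →
      ∀ (θ' : ℝ), 0 ≤ θ' → θ' ≤ 1 →
      ∀ (x₁ x₂ : Balaban1983to89.Site P 0) (n : ℕ) (sq : ℕ → Balaban1983to89.Site P 0) (cb : ℕ → PBond P 0),
        sq 0 = x₁ → sq n = x₂ → (∀ m < n, Joins (cb m) (sq m) (sq (m + 1))) →
        (n : ℝ) ≤ ((d : ℝ) + 1) * B5Ineq137Torus.T P 0 x₁ x₂ →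
        (∀ m ≤ n, sq m ∈ (cubeT hPd (P.L ^ k) c fun i => P.L ^ k * M0 i) ∧
          (∀ i, R₀ ≤ (boxCoord hPd (P.L ^ k) c (sq m) i : ℝ) ∧ (boxCoord hPd (P.L ^ k) c (sq m) i : ℝ) + R₀ ≤ (P.L ^ k * M0 i : ℕ) - 1) ∧
          B5Ineq137Torus.T P 0 x₁ (sq m) ≤ B5Ineq137Torus.T P 0 x₁ x₂) →
      ∀ (f : Balaban1983to89.Site P 0 → ℂ) (F D : ℝ), (∀ y, ‖f y‖ ≤ F) → 0 ≤ D →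
        (∀ y, f y ≠ 0 → D ≤ B5Ineq137Torus.T P 0 x₁ y) → (∀ y, f y ≠ 0 → D ≤ B5Ineq137Torus.T P 0 x₂ y) →
        ((P.L : ℝ) ^ k / B5Ineq137Torus.T P 0 x₁ x₂) ^ θ' *
          ‖toC (chainHol sq cb U n) *
              (gLocT (B1RG242Torus.α P a k * (P.L : ℝ) ^ (k * P.d)) P.eps⁻¹ U k (cubeFam hPd (P.L ^ k) c M0 s W)
                (lamFam hPd (P.L ^ k) c M0 s) ζ *ᵥ f) x₂ -
            (gLocT (B1RG242Torus.α P a k * (P.L : ℝ) ^ (k * P.d)) P.eps⁻¹ U k (cubeFam hPd (P.L ^ k) c M0 s W)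
                (lamFam hPd (P.L ^ k) c M0 s) ζ *ᵥ f) x₁‖ ≤
          P.spacing k ^ 2 * (C * (⌊(((P.L : ℝ) ^ k) - 1 + R₀) / s⌋₊ + 3) ^ (d + 1) *
            (1 + (P.L : ℝ) ^ k * ((R₀ - R₁)⁻¹ + (s : ℝ)⁻¹)) * Real.exp (-(t₀ * (((P.L : ℝ) ^ k)⁻¹ * D))) * F) := by
  obtain ⟨t₁, C₁, ht₁, hC₁, H1⟩ := deriv230_smallPlaquette_op_of_lipschitz d L hd1 hd3 hL ha hK0
  obtain ⟨t₃, c₃, ht₃, hc₃, H3⟩ := decay110_smallPlaquette_cube_uniform d (L - 1) hd3 (by omega) ha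
  set t : ℝ := min t₁ t₃ with htdef
  have ht0 : 0 < t := lt_min ht₁ ht₃
  have htt₁ : t ≤ t₁ := min_le_left _ _
  have htt₃ : t ≤ t₃ := min_le_right _ _
  refine ⟨t, max (((d : ℝ) + 1) * Real.exp t₁ * C₁) (2 * c₃), ht0, lt_max_of_lt_right (by positivity), ?_⟩
  intro P hPd hPL k hk1 hkK hRsz c M0 hM0 hfit0 hN0 s W hs R R₀ R₁ hR hR₁ hR10 hLR₀ hW hgap ζ hζabs hζ0 hζlip U θp hθp0 hplaq hθps T hT
    hsmallT θ hθ0 hθ1 x₁ x₂ n sq cb hsq0 hsqn hJ hnle hchain f F D hF hD hsupp₁ hsupp₂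
  have hPL' : P.L = L - 1 + 1 := by omega
  set C := max (((d : ℝ) + 1) * Real.exp t₁ * C₁) (2 * c₃) with hCdef
  have hCa : ((d : ℝ) + 1) * Real.exp t₁ * C₁ ≤ C := le_max_left _ _
  have hCb : 2 * c₃ ≤ C := le_max_right _ _
  have hC0 : 0 ≤ C := le_trans (by positivity) hCb
  have hn : 1 ≤ P.L ^ k := Nat.one_le_pow _ _ P.L_pos
  have hk : 0 + k ≤ P.m + P.K := by omega
  have hkmK : k ≤ P.m + P.K := by omega
  have hR₀ : 0 ≤ R₀ := hR₁.trans hR10.le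
  have hs0 : 0 < s := hs
  have hLpos : (0 : ℝ) < P.L := P.cast_L_pos
  have hLk : (0 : ℝ) < (P.L : ℝ) ^ k := pow_pos hLpos _
  have hLkinv : 0 < ((P.L : ℝ) ^ k)⁻¹ := inv_pos.mpr hLk
  have hsp0 : 0 < P.spacing k := P.spacing_pos k
  have heps : 0 < P.eps := P.eps_pos
  have hsr : (0 : ℝ) < s := by exact_mod_cast hs
  have hgap' : 0 < R₀ - R₁ := sub_pos.2 hR10
  have hF0 : 0 ≤ F := (norm_nonneg _).trans (hF x₁)
  have hT0 : 0 ≤ B5Ineq137Torus.T P 0 x₁ x₂ := B5Ineq137Torus.T_nonneg P 0 x₁ x₂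
  -- the end points are chain sites
  obtain ⟨hx₁, hdeep₁, -⟩ := hsq0 ▸ hchain 0 (Nat.zero_le n)
  obtain ⟨hx₂, hdeep₂, -⟩ := hsqn ▸ hchain n le_rfl
  -- abbreviations
  set A : ℝ := B1RG242Torus.α P a k * (P.L : ℝ) ^ (k * P.d) with hAdef
  set ψ : Balaban1983to89.Site P 0 → ℂ :=
    gLocT A P.eps⁻¹ U k (cubeFam hPd (P.L ^ k) c M0 s W) (lamFam hPd (P.L ^ k) c M0 s) ζ *ᵥ f with hψdef
  set T12 : ℝ := B5Ineq137Torus.T P 0 x₁ x₂ with hT12def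
  set m : ℝ := ((⌊(((P.L : ℝ) ^ k) - 1 + R₀) / s⌋₊ : ℝ) + 3) ^ (d + 1) with hmdef
  have hm0 : 0 ≤ m := by rw [hmdef]; positivity
  set br : ℝ := 1 + (P.L : ℝ) ^ k * ((R₀ - R₁)⁻¹ + (s : ℝ)⁻¹) with hbrdef
  have hbr1 : 1 ≤ br := by rw [hbrdef]; exact le_add_of_nonneg_right (by positivity)
  have hbr0 : 0 ≤ br := zero_le_one.trans hbr1
  set Ex : ℝ := Real.exp (-(t * (((P.L : ℝ) ^ k)⁻¹ * D))) with hEdef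
  have hE0 : 0 < Ex := Real.exp_pos _
  have hεD : 0 ≤ ((P.L : ℝ) ^ k)⁻¹ * D := mul_nonneg hLkinv.le hD
  set w : ℝ := ((P.L : ℝ) ^ k / T12) ^ θ with hwdef
  have hw0 : 0 ≤ w := Real.rpow_nonneg (div_nonneg hLk.le hT0) θ
  show w * ‖toC (chainHol sq cb U n) * ψ x₂ - ψ x₁‖ ≤ P.spacing k ^ 2 * (C * m * br * Ex * F)
  by_cases hnear : T12 ≤ (P.L : ℝ) ^ k
  · /- NEAR PAIRS -/
    set D' : ℝ := max (D - T12) 0 with hD'def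
    have hD'0 : 0 ≤ D' := le_max_right _ _
    set B : ℝ := P.spacing k * (C₁ * m * br * (Real.exp t₁ * Ex) * F) with hBdef
    have hB0 : 0 ≤ B := by positivity
    have hbond : ∀ m' < n, ‖covD P.eps⁻¹ (cfg U) ψ (cb m')‖ ≤ B := by
      intro m' hm'
      obtain ⟨hmem0, hdeep0, hclose0⟩ := hchain m' hm'.le
      obtain ⟨hmem1, hdeep1, hclose1⟩ := hchain (m' + 1) (Nat.succ_le_of_lt hm')
      have hb : cb m' = ⟨(cb m').src, (cb m').dir⟩ := rfl
      have htgt : (cb m').tgt = (cb m').src.shift (cb m').dir := rfl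
      have hends : ((cb m').src ∈ (cubeT hPd (P.L ^ k) c fun i => P.L ^ k * M0 i) ∧
          (∀ i, R₀ ≤ (boxCoord hPd (P.L ^ k) c (cb m').src i : ℝ) ∧
            (boxCoord hPd (P.L ^ k) c (cb m').src i : ℝ) + R₀ ≤ (P.L ^ k * M0 i : ℕ) - 1) ∧
          B5Ineq137Torus.T P 0 x₁ (cb m').src ≤ T12) ∧
          ((cb m').src.shift (cb m').dir ∈ (cubeT hPd (P.L ^ k) c fun i => P.L ^ k * M0 i) ∧
          (∀ i, R₀ ≤ (boxCoord hPd (P.L ^ k) c ((cb m').src.shift (cb m').dir) i : ℝ) ∧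
            (boxCoord hPd (P.L ^ k) c ((cb m').src.shift (cb m').dir) i : ℝ) + R₀ ≤ (P.L ^ k * M0 i : ℕ) - 1)) := by
        rw [← htgt]
        rcases hJ m' hm' with ⟨h1, h2⟩ | ⟨h1, h2⟩
        · rw [h1, h2]; exact ⟨⟨hmem0, hdeep0, hclose0⟩, hmem1, hdeep1⟩
        · rw [h1, h2]; exact ⟨⟨hmem1, hdeep1, hclose1⟩, hmem0, hdeep0⟩
      obtain ⟨⟨hzmem, hzdeep, hzclose⟩, hzemem, hzedeep⟩ := hends
      have hD'supp : ∀ y, f y ≠ 0 → D' ≤ B5Ineq137Torus.T P 0 (cb m').src y := by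
        intro y hy
        refine max_le ?_ (B5Ineq137Torus.T_nonneg P 0 _ y)
        have h1 := hsupp₁ y hy
        have h2 := B5Ineq137Torus.T_triangle P 0 x₁ (cb m').src y
        linarith
      have hder := H1 P hPd hPL k hk1 hkK hRsz c M0 hM0 hfit0 hN0 s W hs R R₀ R₁ hR hR₁ hR10 hLR₀ hW hgap ζ hζabs hζ0 hζlip U θp hθp0
        hplaq hθps T hT hsmallT (cb m').src (cb m').dir hzmem hzdeep hzemem hzedeep f F D' hF hD'0 hD'supp
      rw [← hb] at hder
      refine hder.trans ?_
      have hTz : D - (P.L : ℝ) ^ k ≤ D' := le_trans (by linarith) (le_max_left _ _)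
      have hexp := exp_near_le ht0 htt₁ hLk hD hTz
      rw [hBdef, ← hmdef, ← hbrdef]
      refine mul_le_mul_of_nonneg_left ?_ hsp0.le
      exact mul_le_mul_of_nonneg_right (mul_le_mul_of_nonneg_left hexp (by positivity)) hF0
    have htel := norm_transport_sub_le_sum_covD U (inv_ne_zero heps.ne') ψ sq cb n hJ
    rw [hsq0, hsqn, abs_inv, abs_of_pos heps, inv_inv] at htel
    have hsum : ∑ m' ∈ Finset.range n, ‖covD P.eps⁻¹ (cfg U) ψ (cb m')‖ ≤ n * B := by
      calc ∑ m' ∈ Finset.range n, ‖covD P.eps⁻¹ (cfg U) ψ (cb m')‖ ≤ ∑ _m' ∈ Finset.range n, B :=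
            Finset.sum_le_sum fun m' hm' => hbond m' (Finset.mem_range.1 hm')
        _ = n * B := by rw [Finset.sum_const, Finset.card_range, nsmul_eq_mul]
    have hdiff : ‖toC (chainHol sq cb U n) * ψ x₂ - ψ x₁‖ ≤ P.eps * (n * B) :=
      htel.trans (mul_le_mul_of_nonneg_left hsum heps.le)
    have hwT : w * (P.eps * (n * B)) ≤ ((d : ℝ) + 1) * (P.eps * (P.L : ℝ) ^ k) * B := by
      rcases hT0.eq_or_lt with hT00 | hTpos
      · have hn0 : (n : ℝ) = 0 := le_antisymm (by rw [← hT00, mul_zero] at hnle; exact hnle) (Nat.cast_nonneg n)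
        rw [hn0, zero_mul, mul_zero, mul_zero]
        positivity
      · have hq : 1 ≤ (P.L : ℝ) ^ k / T12 := by rw [le_div_iff₀ hTpos, one_mul]; exact hnear
        have hw1 : w ≤ (P.L : ℝ) ^ k / T12 := rpow_le_self_of_one_le hq hθ1
        calc w * (P.eps * (n * B)) ≤ (P.L : ℝ) ^ k / T12 * (P.eps * ((((d : ℝ) + 1) * T12) * B)) :=
              mul_le_mul hw1 (mul_le_mul_of_nonneg_left (mul_le_mul_of_nonneg_right hnle hB0) heps.le) (by positivity)
                (div_nonneg hLk.le hT0)
          _ = ((d : ℝ) + 1) * (P.eps * (P.L : ℝ) ^ k) * B := by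
              rw [div_mul_eq_mul_div, div_eq_iff hTpos.ne']
              ring
    have hspacing : P.eps * (P.L : ℝ) ^ k = P.spacing k := by rw [Params.spacing]; ring
    calc w * ‖toC (chainHol sq cb U n) * ψ x₂ - ψ x₁‖ ≤ w * (P.eps * (n * B)) := mul_le_mul_of_nonneg_left hdiff hw0
      _ ≤ ((d : ℝ) + 1) * (P.eps * (P.L : ℝ) ^ k) * B := hwT
      _ = P.spacing k ^ 2 * ((((d : ℝ) + 1) * Real.exp t₁ * C₁) * m * br * Ex * F) := by rw [hspacing, hBdef]; ring
      _ ≤ P.spacing k ^ 2 * (C * m * br * Ex * F) := by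
          refine mul_le_mul_of_nonneg_left ?_ (sq_nonneg _)
          exact mul_le_mul_of_nonneg_right (mul_le_mul_of_nonneg_right (mul_le_mul_of_nonneg_right
            (mul_le_mul_of_nonneg_right hCa hm0) hbr0) hE0.le) hF0
  · /- FAR PAIRS: two operator-form value members under plaquette smallness -/
    push Not at hnear
    have hTpos : 0 < T12 := hLk.trans hnear
    have hw1 : w ≤ 1 := by
      refine Real.rpow_le_one (div_nonneg hLk.le hT0) ?_ hθ0
      rw [div_le_one hTpos]; exact hnear.le
    have hG : ∀ (α : ↥(labels (P.L ^ k) M0 s)) (x : Balaban1983to89.Site P 0) (g : Balaban1983to89.Site P 0 → ℂ) (G E : ℝ),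
        (∀ y, ‖g y‖ ≤ G) → (∀ y, g y ≠ 0 → E ≤ B5Ineq137Torus.T P 0 x y) →
        ‖(gBox A P.eps⁻¹ U k (cubeFam hPd (P.L ^ k) c M0 s W α) *ᵥ g) x‖ ≤
          P.spacing k ^ 2 * (c₃ * Real.exp (-(t₃ * (((P.L : ℝ) ^ k)⁻¹ * E))) * G) := by
      intro α x g G E hG hsuppg
      obtain ⟨c', M', hM', hfit', hN', hcα⟩ := cubeFam_fits (hPd := hPd) (s := s) (W := W) hM0 hfit0 hN0 α
      rw [hcα]
      exact H3 P hPd hPL' k hk1 hkmK hRsz U θp hθp0 hplaq T hT hsmallT c' M' hM' hfit' hN' x g G E hG hsuppg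
    have hval : ∀ x : Balaban1983to89.Site P 0, x ∈ (cubeT hPd (P.L ^ k) c fun i => P.L ^ k * M0 i) →
        (∀ i, R₀ ≤ (boxCoord hPd (P.L ^ k) c x i : ℝ) ∧ (boxCoord hPd (P.L ^ k) c x i : ℝ) + R₀ ≤ (P.L ^ k * M0 i : ℕ) - 1) →
        (∀ y, f y ≠ 0 → D ≤ B5Ineq137Torus.T P 0 x y) → ‖ψ x‖ ≤ P.spacing k ^ 2 * (m * (c₃ * Ex * F)) := by
      intro x hx hdeepx hsuppx
      set S : Finset ↥(labels (P.L ^ k) M0 s) :=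
        (activeLabels hPd (P.L ^ k) c s R₀ (blkIter k x)).subtype fun α => α ∈ labels (P.L ^ k) M0 s with hSdef
      have hS : ∀ (α : ↥(labels (P.L ^ k) M0 s)) (y : Balaban1983to89.Site P 0),
          ζ x y * lamFam hPd (P.L ^ k) c M0 s α x y ≠ 0 → f y ≠ 0 → α ∈ S := by
        intro α y hne _
        rw [hSdef, Finset.mem_subtype]
        exact mem_activeLabels_of_ne_zero_of_deep hk hs0 hfit0 hζ0 (mem_blockK_blkIter x) hdeepx hne
      have hcard : (S.card : ℝ) ≤ m := by
        have h1 := card_subtype_activeLabels_le (hPd := hPd) (c := c) (M0 := M0) hn hs0 hR₀ (blkIter k x)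
        have e : (((P.L ^ k : ℕ) : ℕ) : ℝ) = (P.L : ℝ) ^ k := by push_cast; rfl
        rw [hSdef, hmdef]; rw [e] at h1; exact h1
      have h := opDecay230_of_input A P.eps⁻¹ U (cubeFam hPd (P.L ^ k) c M0 s W) (sum_abs_lamT_le_one hfit0) hζabs hG x f F D hF hsuppx
        S hS
      refine h.trans (mul_le_mul_of_nonneg_left ?_ (sq_nonneg _))
      have hE3 : Real.exp (-(t₃ * (((P.L : ℝ) ^ k)⁻¹ * D))) ≤ Ex :=
        Real.exp_le_exp.2 (neg_le_neg (mul_le_mul_of_nonneg_right htt₃ hεD))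
      calc (S.card : ℝ) * (c₃ * Real.exp (-(t₃ * (((P.L : ℝ) ^ k)⁻¹ * D))) * F) ≤ m * (c₃ * Real.exp (-(t₃ * (((P.L : ℝ) ^ k)⁻¹ * D))) * F) :=
            mul_le_mul_of_nonneg_right hcard (by positivity)
        _ ≤ m * (c₃ * Ex * F) := mul_le_mul_of_nonneg_left (mul_le_mul_of_nonneg_right (mul_le_mul_of_nonneg_left hE3 hc₃.le) hF0) hm0
    have h1 := hval x₁ hx₁ hdeep₁ hsupp₁
    have h2 := hval x₂ hx₂ hdeep₂ hsupp₂
    have hsub : ‖toC (chainHol sq cb U n) * ψ x₂ - ψ x₁‖ ≤ P.spacing k ^ 2 * (m * (c₃ * Ex * F)) + P.spacing k ^ 2 * (m * (c₃ * Ex * F)) := by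
      refine (norm_sub_le _ _).trans (add_le_add ?_ h1)
      rw [norm_mul, norm_toC, one_mul]; exact h2
    calc w * ‖toC (chainHol sq cb U n) * ψ x₂ - ψ x₁‖ ≤ ‖toC (chainHol sq cb U n) * ψ x₂ - ψ x₁‖ :=
          mul_le_of_le_one_left (norm_nonneg _) hw1
      _ ≤ P.spacing k ^ 2 * (m * (c₃ * Ex * F)) + P.spacing k ^ 2 * (m * (c₃ * Ex * F)) := hsub
      _ = P.spacing k ^ 2 * ((2 * c₃) * m * 1 * Ex * F) := by ring
      _ ≤ P.spacing k ^ 2 * (C * m * br * Ex * F) := by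
          refine mul_le_mul_of_nonneg_left ?_ (sq_nonneg _)
          exact mul_le_mul_of_nonneg_right (mul_le_mul_of_nonneg_right
            (mul_le_mul (mul_le_mul_of_nonneg_right hCb hm0) hbr1 zero_le_one (by positivity)) hE0.le) hF0

/-- **THE PLAQUETTE-ONLY COVARIANT-DERIVATIVE MEMBER FOR p13's CUT-OFF OF RECORD** (instance of `deriv230_smallPlaquette_op_of_lipschitz`,
constants from `(d, L, a)` and `K_σ`). [cite: BalabanImbrieJaffe1988, (2.30) p.263] [cite: BalabanImbrieJaffe1985, (7.3.1) p.326] -/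
theorem deriv230_smallPlaquette_op_cwt (d L : ℕ) (hd1 : 1 ≤ d) (hd3 : d + 1 ≤ 3) (hL : Odd L ∧ 1 < L) {a : ℝ} (ha : 0 < a) :
    ∃ t₀ C : ℝ, 0 < t₀ ∧ 0 < C ∧ ∀ (P : Params) (hPd : P.d = d + 1), P.L = L →
      ∀ k : ℕ, 1 ≤ k → k ≤ P.K → 2 * (P.L ^ k - 1) + 4 < P.sitesPerDir 0 → ∀ (c M0 : Fin (d + 1) → ℕ), (∀ i, 1 ≤ M0 i) →
        (∀ i, c i * P.L ^ k + P.L ^ k * M0 i ≤ P.sitesPerDir 0) → (∀ i, P.L ^ k * M0 i < P.sitesPerDir 0) →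
      ∀ (s W : ℕ), 1 ≤ s → ∀ (R R₀ R₁ : ℝ), (P.L : ℝ) ^ k + 1 ≤ R → 0 ≤ R₁ → R₁ < R₀ → (P.L : ℝ) ^ k ≤ R₀ →
        2 * (s : ℝ) / 3 + R₀ / 2 + R ≤ W → (∀ i, ((P.L ^ k * M0 i : ℕ) : ℝ) + R ≤ P.sitesPerDir 0) →
      ∀ (U : GaugeField P 0 U1) (θ : ℝ), 0 ≤ θ →
        (∀ p : Balaban1983to89.Plaq P 0, ‖toC (GaugeField.plaqHol U p) - 1‖ ≤ θ) →
        2 * (P.d : ℝ) ^ 3 * (((P.L : ℝ) ^ k) ^ 2 * θ) ^ 2 ≤ 1 →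
      ∀ (T : ℝ), ((P.d - 1 : ℕ) : ℝ) * ((P.L : ℝ) ^ k - 1) * θ ≤ T →
        2 * (((P.L : ℝ) ^ k - 1) * (P.L : ℝ) ^ k) * P.d * T ^ 2 + 2 * (P.d * ((P.L : ℝ) ^ k - 1) * T) ^ 2 ≤ 1 / 2 →
      ∀ (x : Balaban1983to89.Site P 0) (μ : Fin P.d),
        x ∈ (cubeT hPd (P.L ^ k) c fun i => P.L ^ k * M0 i) →
        (∀ i, R₀ ≤ (boxCoord hPd (P.L ^ k) c x i : ℝ) ∧ (boxCoord hPd (P.L ^ k) c x i : ℝ) + R₀ ≤ (P.L ^ k * M0 i : ℕ) - 1) →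
        x.shift μ ∈ (cubeT hPd (P.L ^ k) c fun i => P.L ^ k * M0 i) →
        (∀ i, R₀ ≤ (boxCoord hPd (P.L ^ k) c (x.shift μ) i : ℝ) ∧
          (boxCoord hPd (P.L ^ k) c (x.shift μ) i : ℝ) + R₀ ≤ (P.L ^ k * M0 i : ℕ) - 1) →
      ∀ (f : Balaban1983to89.Site P 0 → ℂ) (F D : ℝ), (∀ y, ‖f y‖ ≤ F) → 0 ≤ D → (∀ y, f y ≠ 0 → D ≤ B5Ineq137Torus.T P 0 x y) →
        ‖covD P.eps⁻¹ (cfg U)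
            (gLocT (B1RG242Torus.α P a k * (P.L : ℝ) ^ (k * P.d)) P.eps⁻¹ U k (cubeFam hPd (P.L ^ k) c M0 s W)
              (lamFam hPd (P.L ^ k) c M0 s) (cutoff R₁ R₀ (B5Ineq137Torus.T P 0)) *ᵥ f) ⟨x, μ⟩‖ ≤
          P.spacing k * (C * (⌊(((P.L : ℝ) ^ k) - 1 + R₀) / s⌋₊ + 3) ^ (d + 1) *
            (1 + (P.L : ℝ) ^ k * ((R₀ - R₁)⁻¹ + (s : ℝ)⁻¹)) * Real.exp (-(t₀ * (((P.L : ℝ) ^ k)⁻¹ * D))) * F) := by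
  obtain ⟨K, hK0, hK⟩ := exists_abs_cutoff_sub_le.{0, 0}
  obtain ⟨t₀, C, ht₀, hC, H⟩ := deriv230_smallPlaquette_op_of_lipschitz d L hd1 hd3 hL ha hK0
  refine ⟨t₀, C, ht₀, hC, ?_⟩
  intro P hPd hPL k hk1 hkK hRsz c M0 hM0 hfit0 hN0 s W hs R R₀ R₁ hR hR₁ hR10 hLR₀ hW hgap U θ hθ0 hplaq hθs T hT hsmallT
    x μ hx hdeep hxe hdeepe f F D hF hD hsupp
  obtain ⟨h1, h2, h3⟩ := cutoff_hyps (hK R₁ R₀ hR10 (B5Ineq137Torus.T P 0)) hK0 hR10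
  exact H P hPd hPL k hk1 hkK hRsz c M0 hM0 hfit0 hN0 s W hs R R₀ R₁ hR hR₁ hR10 hLR₀ hW hgap _ h1 h2 h3 U θ hθ0 hplaq hθs T hT hsmallT
    x μ hx hdeep hxe hdeepe f F D hF hD hsupp

/-- **THE PLAQUETTE-ONLY HÖLDER MEMBER OF ORDER `θ' ≤ 1` ALONG A SHORTEST CONTOUR FOR p13's CUT-OFF OF RECORD** ([6] (1.9)'s ∃-form for
pairs at chart depth `≥ R₀` with `|x₁ − x₂|_T ≤ R₀`; gen 29's `exists_admissible_contour`).
[cite: BalabanImbrieJaffe1988, (2.30) p.263] [cite: BalabanImbrieJaffe1985, (7.3.1) p.326] -/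
theorem exists_contour_holder230_smallPlaquette_op_cwt (d L : ℕ) (hd1 : 1 ≤ d) (hd3 : d + 1 ≤ 3) (hL : Odd L ∧ 1 < L) {a : ℝ}
    (ha : 0 < a) :
    ∃ t₀ C : ℝ, 0 < t₀ ∧ 0 < C ∧ ∀ (P : Params) (hPd : P.d = d + 1), P.L = L →
      ∀ k : ℕ, 1 ≤ k → k ≤ P.K → 2 * (P.L ^ k - 1) + 4 < P.sitesPerDir 0 → ∀ (c M0 : Fin (d + 1) → ℕ), (∀ i, 1 ≤ M0 i) →
        (∀ i, c i * P.L ^ k + P.L ^ k * M0 i ≤ P.sitesPerDir 0) → (∀ i, P.L ^ k * M0 i < P.sitesPerDir 0) →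
      ∀ (s W : ℕ), 1 ≤ s → ∀ (R R₀ R₁ : ℝ), (P.L : ℝ) ^ k + 1 ≤ R → 0 ≤ R₁ → R₁ < R₀ → (P.L : ℝ) ^ k ≤ R₀ →
        2 * (s : ℝ) / 3 + R₀ / 2 + R ≤ W → (∀ i, ((P.L ^ k * M0 i : ℕ) : ℝ) + R ≤ P.sitesPerDir 0) →
      ∀ (U : GaugeField P 0 U1) (θ : ℝ), 0 ≤ θ →
        (∀ p : Balaban1983to89.Plaq P 0, ‖toC (GaugeField.plaqHol U p) - 1‖ ≤ θ) →
        2 * (P.d : ℝ) ^ 3 * (((P.L : ℝ) ^ k) ^ 2 * θ) ^ 2 ≤ 1 →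
      ∀ (T : ℝ), ((P.d - 1 : ℕ) : ℝ) * ((P.L : ℝ) ^ k - 1) * θ ≤ T →
        2 * (((P.L : ℝ) ^ k - 1) * (P.L : ℝ) ^ k) * P.d * T ^ 2 + 2 * (P.d * ((P.L : ℝ) ^ k - 1) * T) ^ 2 ≤ 1 / 2 →
      ∀ (x₁ x₂ : Balaban1983to89.Site P 0),
        x₁ ∈ (cubeT hPd (P.L ^ k) c fun i => P.L ^ k * M0 i) →
        (∀ i, R₀ ≤ (boxCoord hPd (P.L ^ k) c x₁ i : ℝ) ∧ (boxCoord hPd (P.L ^ k) c x₁ i : ℝ) + R₀ ≤ (P.L ^ k * M0 i : ℕ) - 1) →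
        x₂ ∈ (cubeT hPd (P.L ^ k) c fun i => P.L ^ k * M0 i) →
        (∀ i, R₀ ≤ (boxCoord hPd (P.L ^ k) c x₂ i : ℝ) ∧ (boxCoord hPd (P.L ^ k) c x₂ i : ℝ) + R₀ ≤ (P.L ^ k * M0 i : ℕ) - 1) →
        B5Ineq137Torus.T P 0 x₁ x₂ ≤ R₀ →
      ∃ (N : ℕ) (sq : ℕ → Balaban1983to89.Site P 0) (cb : ℕ → PBond P 0), sq 0 = x₁ ∧ sq N = x₂ ∧
        (∀ m < N, Joins (cb m) (sq m) (sq (m + 1))) ∧ (N : ℝ) ≤ ((d : ℝ) + 1) * B5Ineq137Torus.T P 0 x₁ x₂ ∧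
      ∀ (θ' : ℝ), 0 ≤ θ' → θ' ≤ 1 →
      ∀ (f : Balaban1983to89.Site P 0 → ℂ) (F D : ℝ), (∀ y, ‖f y‖ ≤ F) → 0 ≤ D →
        (∀ y, f y ≠ 0 → D ≤ B5Ineq137Torus.T P 0 x₁ y) → (∀ y, f y ≠ 0 → D ≤ B5Ineq137Torus.T P 0 x₂ y) →
        ((P.L : ℝ) ^ k / B5Ineq137Torus.T P 0 x₁ x₂) ^ θ' *
          ‖toC (chainHol sq cb U N) *
              (gLocT (B1RG242Torus.α P a k * (P.L : ℝ) ^ (k * P.d)) P.eps⁻¹ U k (cubeFam hPd (P.L ^ k) c M0 s W)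
                (lamFam hPd (P.L ^ k) c M0 s) (cutoff R₁ R₀ (B5Ineq137Torus.T P 0)) *ᵥ f) x₂ -
            (gLocT (B1RG242Torus.α P a k * (P.L : ℝ) ^ (k * P.d)) P.eps⁻¹ U k (cubeFam hPd (P.L ^ k) c M0 s W)
                (lamFam hPd (P.L ^ k) c M0 s) (cutoff R₁ R₀ (B5Ineq137Torus.T P 0)) *ᵥ f) x₁‖ ≤
          P.spacing k ^ 2 * (C * (⌊(((P.L : ℝ) ^ k) - 1 + R₀) / s⌋₊ + 3) ^ (d + 1) *
            (1 + (P.L : ℝ) ^ k * ((R₀ - R₁)⁻¹ + (s : ℝ)⁻¹)) * Real.exp (-(t₀ * (((P.L : ℝ) ^ k)⁻¹ * D))) * F) := by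
  obtain ⟨K, hK0, hK⟩ := exists_abs_cutoff_sub_le.{0, 0}
  obtain ⟨t₀, C, ht₀, hC, H⟩ := holder230_smallPlaquette_op_of_lipschitz d L hd1 hd3 hL ha hK0
  refine ⟨t₀, C, ht₀, hC, ?_⟩
  intro P hPd hPL k hk1 hkK hRsz c M0 hM0 hfit0 hN0 s W hs R R₀ R₁ hR hR₁ hR10 hLR₀ hW hgap U θ hθ0 hplaq hθs T hT hsmallT
    x₁ x₂ hx₁ hdeep₁ hx₂ hdeep₂ hT12
  obtain ⟨h1, h2, h3⟩ := cutoff_hyps (hK R₁ R₀ hR10 (B5Ineq137Torus.T P 0)) hK0 hR10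
  obtain ⟨N, sq, cb, h0, hN, hJ, hNle, hchain⟩ := exists_admissible_contour hPd hfit0 hx₁ hdeep₁ hx₂ hdeep₂ hT12
  refine ⟨N, sq, cb, h0, hN, hJ, hNle, fun θ' hθ'0 hθ'1 f F D hF hD hD₁ hD₂ => ?_⟩
  have hchain' : ∀ m ≤ N, sq m ∈ (cubeT hPd (P.L ^ k) c fun i => P.L ^ k * M0 i) ∧
      (∀ i, R₀ ≤ (boxCoord hPd (P.L ^ k) c (sq m) i : ℝ) ∧ (boxCoord hPd (P.L ^ k) c (sq m) i : ℝ) + R₀ ≤ (P.L ^ k * M0 i : ℕ) - 1) ∧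
      B5Ineq137Torus.T P 0 x₁ (sq m) ≤ B5Ineq137Torus.T P 0 x₁ x₂ := fun m hm => by
    obtain ⟨h1, h2, h3⟩ := hchain m hm
    exact ⟨h1, fun i => by simpa only [min_self] using h2 i, h3⟩
  exact H P hPd hPL k hk1 hkK hRsz c M0 hM0 hfit0 hN0 s W hs R R₀ R₁ hR hR₁ hR10 hLR₀ hW hgap _ h1 h2 h3 U θ hθ0 hplaq hθs T hT hsmallT
    θ' hθ'0 hθ'1 x₁ x₂ N sq cb h0 hN hJ hNle hchain' f F D hF hD hD₁ hD₂

end Plaquette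

/-! ## §6 (v1.2) Non-vacuity: every hypothesis of `deriv230_smallPlaquette_op_cwt` met at once on a genuine two-dimensional `Setup.Params` torus -/

section Instance

open BIJ88Cutoffs21 (cutoff)
open B4Reflection242 (boxDom mem_boxDom)
open BIJ88Sect3Statements (toC_one)

/-- The parameters of the instance: `d = 2` directions (`P.d = 1 + 1`), `L = 3`, `m = 1`, `K = 3` — `2·3⁴ = 162` fine sites per direction.
[cite: Balaban1987RG1, (0.1) p.251] -/
private abbrev P2 : Params := { d := 2, L := 3, m := 1, K := 3, hd := by norm_num, hL := ⟨⟨1, rfl⟩, by norm_num⟩ }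

/-- `|T^{(0)}| = 162` per direction. [cite: Balaban1987RG1, (0.1) p.251] -/
private theorem sites_P2 : P2.sitesPerDir 0 = 162 := by decide

/-- **THE HYPOTHESES OF `deriv230_smallPlaquette_op_cwt` ARE JOINTLY SATISFIABLE** (the member is not a statement about the empty set): on
the two-dimensional `Setup` torus `(ℤ/162)²` (`d + 1 = 2`, `L = 3` odd), at `k = 1` (`2(L^k − 1) + 4 = 8 < 162`), box `Ω₀ = [0, 12)²` (`c = 0`,
`M₀ = 4`), cube spacing `s = 1`, half-width `W = 7`, radii `R = L^k + 1 = 4`, `R₁ = 0`, `R₀ = L^k = 3`, the trivial field `u = 1` (all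
plaquette variables `= 1`, so `θ = 0`, `T = 0`), the bond `⟨(5,5), (6,5)⟩` (both ends at chart depth `≥ 3`): every displayed hypothesis holds;
consequently the covariant-derivative bound applies there for every source `f`. [cite: BalabanImbrieJaffe1988, (2.30) p.263] -/
theorem deriv230_smallPlaquette_op_cwt_instance :
    ∃ t₀ C : ℝ, 0 < t₀ ∧ 0 < C ∧ ∀ (f : Balaban1983to89.Site P2 0 → ℂ) (F D : ℝ), (∀ y, ‖f y‖ ≤ F) → 0 ≤ D →
      (∀ y, f y ≠ 0 → D ≤ B5Ineq137Torus.T P2 0 (cubePt (d := 1) rfl (P2.L ^ 1) (fun _ => 0) ![5, 5]) y) →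
      ‖covD P2.eps⁻¹ (cfg (1 : GaugeField P2 0 U1))
          (gLocT (B1RG242Torus.α P2 1 1 * (P2.L : ℝ) ^ (1 * P2.d)) P2.eps⁻¹ (1 : GaugeField P2 0 U1) 1
            (cubeFam (d := 1) rfl (P2.L ^ 1) (fun _ => 0) (fun _ => 4) 1 7) (lamFam (d := 1) rfl (P2.L ^ 1) (fun _ => 0) (fun _ => 4) 1)
            (cutoff 0 3 (B5Ineq137Torus.T P2 0)) *ᵥ f)
          ⟨cubePt (d := 1) rfl (P2.L ^ 1) (fun _ => 0) ![5, 5], Fin.cast (rfl : P2.d = 1 + 1).symm 0⟩‖ ≤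
        P2.spacing 1 * (C * (⌊(((P2.L : ℝ) ^ 1) - 1 + 3) / (1 : ℕ)⌋₊ + 3) ^ (1 + 1) *
          (1 + (P2.L : ℝ) ^ 1 * ((3 - 0 : ℝ)⁻¹ + ((1 : ℕ) : ℝ)⁻¹)) * Real.exp (-(t₀ * (((P2.L : ℝ) ^ 1)⁻¹ * D))) * F) := by
  obtain ⟨t₀, C, ht₀, hC, H⟩ := deriv230_smallPlaquette_op_cwt 1 3 le_rfl (by norm_num) ⟨⟨1, rfl⟩, by norm_num⟩ one_pos
  refine ⟨t₀, C, ht₀, hC, fun f F D hF hD hsupp => ?_⟩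
  have hfit : ∀ i : Fin (1 + 1), (fun _ => 0 : Fin (1 + 1) → ℕ) i * P2.L ^ 1 + P2.L ^ 1 * (fun _ => 4 : Fin (1 + 1) → ℕ) i ≤ P2.sitesPerDir 0 :=
    fun _ => by rw [sites_P2]; norm_num
  have hN0 : ∀ i : Fin (1 + 1), P2.L ^ 1 * (fun _ => 4 : Fin (1 + 1) → ℕ) i < P2.sitesPerDir 0 := fun _ => by rw [sites_P2]; norm_num
  have hgap : ∀ i : Fin (1 + 1), ((P2.L ^ 1 * (fun _ => 4 : Fin (1 + 1) → ℕ) i : ℕ) : ℝ) + 4 ≤ P2.sitesPerDir 0 := fun _ => by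
    rw [sites_P2]; norm_num
  have hsz : 2 * (P2.L ^ 1 - 1) + 4 < P2.sitesPerDir 0 := by rw [sites_P2]; norm_num
  -- the two bond ends in the chart
  have hz5 : (![5, 5] : Fin (1 + 1) → ℤ) ∈ boxDom (fun i : Fin (1 + 1) => P2.L ^ 1 * (fun _ => 4 : Fin (1 + 1) → ℕ) i) := by
    rw [mem_boxDom]; intro i; fin_cases i <;> norm_num
  have hz6 : (![6, 5] : Fin (1 + 1) → ℤ) ∈ boxDom (fun i : Fin (1 + 1) => P2.L ^ 1 * (fun _ => 4 : Fin (1 + 1) → ℕ) i) := by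
    rw [mem_boxDom]; intro i; fin_cases i <;> norm_num
  have hshift : (cubePt (d := 1) rfl (P2.L ^ 1) (fun _ => 0) ![5, 5]).shift (Fin.cast (rfl : P2.d = 1 + 1).symm 0) =
      cubePt (d := 1) rfl (P2.L ^ 1) (fun _ => 0) ![6, 5] := by
    rw [← cubePt_add_single]
    congr 1
    funext j
    fin_cases j <;> simp
  have hplaq : ∀ p : Balaban1983to89.Plaq P2 0, ‖toC (GaugeField.plaqHol (1 : GaugeField P2 0 U1) p) - 1‖ ≤ 0 := by
    intro p
    have : GaugeField.plaqHol (1 : GaugeField P2 0 U1) p = 1 := by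
      show (1 : U1) * 1 * (1 : U1)⁻¹ * (1 : U1)⁻¹ = 1
      simp
    rw [this, toC_one, sub_self, norm_zero]
  refine H P2 rfl rfl 1 le_rfl (by decide) hsz (fun _ => 0) (fun _ => 4) (fun _ => by norm_num) hfit hN0 1 7 le_rfl 4 3 0 (by norm_num) le_rfl
    (by norm_num) (by norm_num) (by norm_num) hgap (1 : GaugeField P2 0 U1) 0 le_rfl hplaq (by norm_num) 0 (by norm_num) (by norm_num) _ _
    (cubePt_mem_cubeT rfl hz5) (fun i => ?_) ?_ (fun i => ?_) f F D hF hD hsupp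
  · rw [boxCoord_cubePt rfl hfit hz5]; fin_cases i <;> norm_num
  · rw [hshift]; exact cubePt_mem_cubeT rfl hz6
  · rw [hshift, boxCoord_cubePt rfl hfit hz6]; fin_cases i <;> norm_num

end Instance

end

end Literature.MathematicalPhysics.QuantumFieldTheory.BalabanImbrieJaffe1984to88.BIJ88LocDeriv230SmallFieldOpTorus
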